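import Summits.ResolutionOfSingularities.ResolutionOfSingularities.Theses.PAlteration
import Literature.AlgebraicGeometry.Resolution.AlterationsResolution
import Literature.AlgebraicGeometry.Resolution.AlterationsProofs
import Literature.AlgebraicGeometry.Resolution.NonReducedNoResolution
import Literature.AlgebraicGeometry.Resolution.AbsoluteIntegralClosureNoResolution
import Literature.AlgebraicGeometry.Resolution.ResolutionOfComponents
import Literature.AlgebraicGeometry.Resolution.ProjectiveSpaceRegular
import Literature.AlgebraicGeometry.Resolution.QuasiProjectiveResolution
import Literature.AlgebraicGeometry.Resolution.ResolutionProjectiveReduction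
import Literature.AlgebraicGeometry.Resolution.RegularLocalRingsNormal

/-!
# Disproof of `PalterationThesis` (crux stmt-ResolutionOfSingularities-0552) — findings

Standing adversary work file (cdisprove, gen 1, v1.5 2026-08-16,
refuter-cdisprove-stmt-ResolutionOfSingularities-0552-0). Prose only in docstrings; every
`theorem` below is sorry-free. NEAR-MISSES (paper arguments not yet formalised) are recorded as
prose in §5, not as `sorry`s.

LANDED (importable, namespace `…Theorems.PalterationThesis.Negative`, all axioms standard):
* `Theorems/PalterationThesis/Negative/LoadBearing.lean` (p90830, commit 062b1595f570):
  `not_summit_of_not_palterationThesis`, `pialt_false_without_irreducible_at`,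
  `pialt_iff_irreducible`, `picover_iff_reducedX`, `picover_without_surjective_iff_resolutionInChar`.
* `Theorems/PalterationThesis/Negative/PicoverFiniteLoadBearing.lean` (p91163, commit
  be489093c54f): `picover_false_without_isFinite(_at)`, `universallyInjective_spec_perfRad`,
  `surjective_spec_perfRad`, `not_hasResolution_spec_perfRad`, `perfRad_*`.
* `Theorems/PalterationThesis/Negative/PicoverContent.lean` (p91555, submitted):
  `picover_strengthening_isRegular_false`, `not_isRegular_spec_hcusp`, `*_hcuspCover`.
* Evidence only (positive glue, a prover may land it): `LocalModelOfPicover.lean` on stmt-0557 —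
  `picoverLocalModel_of_picover : Picover → PicoverLocalModel` (§1 bis).
SIBLING CRUX FILES (the conjuncts and the other route items have their own standing disprovers,
whose landed lemmas this file does NOT duplicate in `Theorems/`): `Cruxes/Pialt/Disproof.lean` +
`Theorems/Pialt/Negative/{LoadBearing,FiniteTypeLoadBearing,FiniteStrengtheningFalse}.lean`
(stmt-0555: summit ⇒ PIAlt, `IsIntegral`/finite-type load-bearing, UI ↦ de Jong, the strengthening
"finite radicial over ALL of `X`" FALSE via a nodal curve); `Cruxes/Picover/Disproof.lean` +
`Theorems/Picover/Negative/RadicialCover.lean` (stmt-0554: dual numbers, `IsIntegral Y` redundant,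
`IsRegular Y` ↦ summit, and — PROVED there — finite type of the REGULAR BASE is load-bearing via
Nagata's non-Japanese DVR, my near-miss (d)); `Cruxes/PicoverLocalModel/Disproof.lean`,
`Cruxes/PicoverToRadicialBottom/Disproof.lean`.

THE CRUX. `PalterationThesis` (route pAlteration, rank-0 thesis statement, auto-crux 2026-08-16) is
`∀ p prime, PIAlt_p ∧ PICover_p` (`crux_iff`, `crux_iff_pialt_and_picover`):
* PIAlt_p (`PialtAt p` = route item `Pialt` at `p`, stmt-0555): every integral separated `X` of
  finite type over a field `k` of characteristic `p` admits `g : X' → X` proper surjective with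
  `X'` integral regular and `g` finite and universally injective (radicial) over a dense open of
  `X` — the Abramovich–Oort conjecture (Temkin 2013, Conj. 1.3.1), open;
* PICover_p (`PicoverAt p` = route item `Picover` at `p`, stmt-0554): every integral `X` finite,
  universally injective and surjective over a regular integral separated `Y` of finite type over
  `k` has a resolution (`Scheme.HasResolution`) — the "inseparable case", open from dimension 4.

FINDINGS (v1.4 = v1.3 + §1 bis `picoverLocalModel_of_picover` (0554 ⇒ 0557); v1.3 = v1.2 + §5 formal `picover_strengthening_isRegular_false`; v1.2 = v1.1 + `pialt_iff_irreducible`, `picover_iff_reducedX`; v1.1 = v1.0 + §3 bis).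
* §1 WEB. THE CRUX IS SUMMIT-IMPLIED: `ResolutionOfSingularities → PalterationThesis`
  (`crux_of_summit`; PIAlt: a resolution of an integral `X` IS a purely inseparable regular
  alteration, finite and radicial over the open where it is an isomorphism —
  `IsResolution.isPurelyInseparableAlteration` in tree; PICover: `X` is itself a reduced separated
  `k`-scheme of finite type). Hence `¬ crux → ¬ summit` (`not_summit_of_not_crux`): A KILL OF THIS
  CRUX IS A COUNTEREXAMPLE TO RESOLUTION OF SINGULARITIES IN POSITIVE CHARACTERISTIC. The same holds
  for EVERY item of the route (`pialt_of_summit`, `picover_of_summit`,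
  `picoverToRadicialBottom_of_summit`, `picoverLocalModel_of_summit`), so modulo the by-name frame
  `Assembly2` (stmt-10476, pure assembly) the summit is EQUIVALENT to `crux ∧ PicoverToRadicialBottom`
  (`summit_iff_crux_and_radicialBottom`). In particular the route's own KILL CRITERION ("a variety
  with no purely inseparable regular alteration closes the route") is not cheaper than refuting
  the summit: such a variety has no resolution at all. INSIDE the route (§1 bis): the rank-5 local
  model is a special case of the rank-2 crux, `picoverLocalModel_of_picover : Picover →
  PicoverLocalModel` (`Spec (R[T]/(T^p - a))_red → Spec R` is finite, universally injective —
  `universallyInjective_adjoinRoot_red`, the class of `T` is the unique `p`-th root of `a` in any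
  field — and surjective, with reduced source; reduced suffices by `picover_iff_reducedX`). So
  stmt-0557 is REDUNDANT given stmt-0554 (information for the planner; a prover may land it).
* §2 PIAlt — LOAD-BEARING HYPOTHESES, as theorems (at every prime `p`).
  - `IsIntegral X` dropped ⇒ FALSE (`pialt_false_without_isIntegral_empty`: the empty scheme;
    and, keeping `X` reduced and non-empty, `pialt_false_without_irreducible`: `Spec (𝔽_p × 𝔽_p)`
    — the image of the integral `X'` under the surjection `g` is irreducible). What is used is
    IRREDUCIBILITY; reducedness of `X` is NOT load-bearing: `pialt_iff_irreducible` — PIAlt at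
    `p` is EQUIVALENT to its version for irreducible, possibly non-reduced `X` (compose an
    alteration of `X_red`, the integral reduced closed subscheme on `⊤`, with the closed immersion
    `X_red → X`, finite, radicial and a homeomorphism).
  - `LocallyOfFiniteType f` dropped ⇒ FALSE (`pialt_false_without_locallyOfFiniteType_at`), for a
    reason cruder than resolution: NO integral scheme with Noetherian stalks (let alone a regular
    one) surjects onto `Spec 𝔽_p[T]⁺`, the absolute integral closure of the affine line
    (`false_of_surjective_of_forall_exists_pow_eq`: `R → 𝒪_{X',x₁}` over a non-zero prime `Q`
    sends `Q`, all of whose elements are `2^k`-th powers of elements of `Q`, into `⋂ₖ 𝔪^k = 0`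
    (Krull), while `R → Γ(X')` is injective, the germ of `r ≠ 0` at a point over the generic
    point being a unit). Properness / finiteness of `g` are not even used.
  - `IsSeparated f`, `QuasiCompact f` dropped ⇒ not attackable cheaply (contain the crux; a
    non-separated or non-quasi-compact integral `X` still has regular alterations glued from an
    affine cover only if those are canonical — no junk model bites). Only the trivial direction
    is recorded (`not_pialtWithoutSeparated_of_not`, `not_pialtWithoutQuasiCompact_of_not`).
  - CONCLUSION MUTATION: dropping the radiciality clause `UniversallyInjective (g ∣_ U)` from the
    conclusion gives EXACTLY de Jong's regular-alteration statement in characteristic `p`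
    (`pialtWithoutUIAt_iff_deJongAt`), a THEOREM in print (named fact `DeJong1996`, de Jong 1996
    Thm. 4.1; `pialtWithoutUIAt_of_deJong1996`). So the single clause "`g` radicial over a dense
    open" carries the entire open content of PIAlt; strengthening it to "`g` an isomorphism over a
    dense open" gives back resolution itself (§1).
* §3 PICover — LOAD-BEARING HYPOTHESES, as theorems (at every prime `p`).
  - `IsIntegral X` dropped ⇒ FALSE (`picover_false_without_isIntegralX_at`): `Spec 𝔽_p[ε] →
    Spec 𝔽_p` is finite, surjective and universally injective
    (`universallyInjective_spec_dualNumber`, via the `K`-points criterion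
    `tfae_universallyInjective`: a `K`-point kills `ε`), and `Spec 𝔽_p[ε]` has no resolution
    (`not_hasResolution_spec_dualNumber`, tree). Weakening `IsIntegral X` to `IsReduced X` gives
    an EQUIVALENT statement (`picover_iff_reducedX`: a finite radicial surjection is a
    homeomorphism, so `X` is irreducible with `Y`).
  - `IsIntegral Y` is REDUNDANT (`picover_integralY_redundant`): `Y` is reduced (regular,
    `Scheme.IsRegular.isReduced`) and irreducible (continuous image of the integral `X` under the
    surjection `g`). Information for the planner: the hypothesis is decoration.
  - `Scheme.IsRegular Y` dropped ⇒ LITERALLY `ResolutionInChar p`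
    (`picover_without_regularY_iff`: take `Y = X`, `g = 𝟙`; reduced → integral by
    `hasResolution_of_forall_closeds`). Regularity of the base is THE hypothesis.
  - `Function.Surjective g.base` dropped ⇒ again LITERALLY `ResolutionInChar p`
    (`picover_without_surjective_iff`: a closed immersion is finite and radicial; Chow
    (`ChowLemmaIntegral_holds`) + projective closure (`exists_projectiveClosure`) embed a proper
    birational model of any integral `X` as a closed subscheme of the regular integral `ℙⁿ_k`;
    transport by `Scheme.HasResolution.of_isOpenImmersion` / `of_isBirational`). Surjectivity is
    what confines PICover to radicial COVERS rather than arbitrary subvarieties.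
  - `UniversallyInjective g` dropped ⇒ sandwiched between `ResolutionInChar p` and resolution of
    every integral `X` finite surjective over a regular integer `Y` (all affine / projective
    varieties, by Noether normalisation) — open, not attackable; trivial direction only
    (`not_picoverWithoutUI_of_not_resolutionInChar`).
  - `IsFinite g` dropped ⇒ FALSE at every prime (`picover_false_without_isFinite_at`, §3 bis):
    `Spec 𝔽_p[T]^{1/p^∞} → 𝔸¹ = Spec 𝔽_p[T]` (the `p`-radical closure of `𝔽_p[T]` in an
    algebraic closure of `𝔽_p(T)`, Mathlib's `Subalgebra.perfectClosure`) is universally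
    injective (`universallyInjective_spec_perfRad`: `K`-points criterion + injectivity of the
    iterated Frobenius on fields) and surjective (`surjective_spec_perfRad`: lying over) from an
    integral scheme onto the regular integral affine line, and its source has no resolution
    (`not_hasResolution_spec_perfRad`: every element is a `p`-th power and the generic point is not
    open, `not_hasResolution_spec_of_forall_exists_pow_eq`). Perfection-type radicial covers kill
    Noetherianity: finiteness of `g` is what any proof must use (cf. the route's rank-4 worry that
    the Frobenius factorisation is finite iff `[k:k^p] < ∞`).
  - `LocallyOfFiniteType f` (finite type of the REGULAR BASE `Y`) dropped ⇒ FALSE on paper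
    (NEAR-MISS §5 (d): a radicial degree-`p` cover `Spec R[s]/(s^p - a)` of a non-Japanese DVR `R`
    of characteristic `p` is a one-dimensional Noetherian local domain whose normalisation is not
    finite, hence has no proper birational regular model) — excellence of `Y` is load-bearing.
  - `IsSeparated f`, `QuasiCompact f` dropped ⇒ not attackable cheaply (as in §2).
* §4 DEGENERATE INSTANCES DO NOT BITE: hypotheses of both conjuncts are jointly satisfiable with
  true conclusion (`pialt_hypotheses_satisfiable`, `picover_hypotheses_satisfiable`: `Spec 𝔽_p`,
  identities); dimension `≤ 3` of BOTH conjuncts is settled modulo the named fact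
  `CossartPiltant2019` (`pialt_of_dim_le_three` via `abramovichOort_of_cossartPiltant2019`;
  `picover_of_dim_le_three`: a finite radicial `g` is a closed embedding of spaces, so
  `dim X ≤ dim Y`). A kill lives in dimension `≥ 4`.
* §5 NATURAL STRENGTHENINGS / NEAR-MISSES (prose, paper arguments):
  (a) PIAlt with `U = X` ("a finite radicial REGULAR COVER exists", no modification): FALSE
      already for the nodal cubic `xy = x³ + y³` over any field — a finite radicial cover by a
      regular (normal) curve factors through the normalisation, which has two points over the
      node, contradicting injectivity. So the modification part of an alteration is needed as
      soon as `X` is not geometrically unibranch. Not formalised (needs normalisation of curves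
      with branch count).
  (b) PICover with conclusion "`X` regular": FALSE at every prime already for curves —
      FORMAL in v1.3, `picover_strengthening_isRegular_false`: `Spec 𝔽_p[T^p, T^{p+1}] → 𝔸¹ =
      Spec 𝔽_p[s]` (`s ↦ T^p`) is finite (`isFinite_hcuspCover`: integral — `a^p ∈ 𝔽_p[T^p]` —
      and of finite type), universally injective (`universallyInjective_hcuspCover`: `K`-points
      + Frobenius injective), surjective (`surjective_hcuspCover`: lying over), with integral
      SINGULAR source (`not_isRegular_spec_hcusp`: `T = T^{p+1}/T^p` is integral, not in the
      ring; regular local rings are normal, Matsumura 19.4). So PICover has content in dimension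
      1 at every `p` (resolved there by normalisation), and its hypotheses have a non-degenerate
      inhabitant.
  (c) (settled in v1.1 as `picover_false_without_isFinite_at`, §3 bis.)
  (d) PICover without finite type of `Y`: Nagata's non-Japanese DVR; far from the tree.
* Targets: none yet (payload `stuck_stubs = []`, no line picked on this crux).

BARRIER CATALOGUE (`Literature/Barriers/ResolutionOfSingularities/`) versus THIS crux.
* `DimensionFourFrontier` — frontier entry (open from dim 4), consistent with §4; asserts no
  falsity. Applies to PICover verbatim (a finite radicial cover of a regular 4-fold is where
  kangaroo / Hauser–Perlega phenomena live) but yields no `¬`.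
* `InseparableBaseChange(Resolution)`, `RegularNotGeometricallyRegular`, `FrobeniusTwistResolution`
  — concern smoothness / base change over imperfect fields; the crux asks for REGULAR `X'` and is
  absolute, so they bear on the assembly step (stmt-0556, `[k:k^p] = ∞`), not on the crux.
* `QuasiExcellenceNecessary` — bites only statements wider than finite type over a field; §2/§3
  show finite type must indeed be kept on both sides (`X` in PIAlt, `Y` in PICover).
* `LocalMonomializationFails*` (Cutkosky), `ArtinSchreierPuiseux`, `NarasimhanMaximalContact`,
  `KangarooShadeIncrease`, `ResidualOrderUnbounded*`, `hauserPerlega…` — failures of STRATEGIES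
  (monomialisation of morphisms, Puiseux parametrisation, maximal contact, residual order), not
  existence statements; none yields `¬ PIAlt_p` or `¬ PICover_p`.
`ledger negatives --problem ResolutionOfSingularities`: 0 refuted statements bear on this crux.

WHY IT RESISTS. Both conjuncts are CONSEQUENCES of the summit statement (§1), faithfully typed
(each hypothesis is either provably necessary with an in-tree witness, provably redundant, or
provably "the whole summit" when dropped — §2, §3), non-vacuous and settled up to dimension 3
(§4). A refutation must therefore exhibit a variety of dimension `≥ 4` over a field of
characteristic `p` WITHOUT resolution of singularities — a counterexample to the resolution
conjecture itself, of which none is in print or in the barrier catalogue. Cheap attacks (junk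
models, degenerate parameters, hypothesis mutation, small models) are exhausted by §2–§4; what is
informative for provers is WHERE the content sits: in PIAlt entirely in the radiciality clause
over de Jong's theorem (§2), in PICover entirely in the pair (regular base, surjective radicial
finite `g`) (§3).
-/

noncomputable section

open CategoryTheory AlgebraicGeometry TopologicalSpace Topology
open Literature.AlgebraicGeometry.Resolution
open Summit.ResolutionOfSingularities.ResolutionOfSingularities.Theses.PAlteration

set_option linter.dupNamespace false

namespace Summit.ResolutionOfSingularities.ResolutionOfSingularities.Cruxes.PalterationThesis.Disproof

/-! ## §0 The crux by name -/

/-- PIAlt at `p` (the body of route item `Pialt`, stmt-0555, at a fixed `p`): purely inseparable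
regular alterations of integral separated schemes of finite type over fields of characteristic
`p`. -/
def PialtAt (p : ℕ) : Prop :=
  ∀ (k : Type) [Field k] [CharP k p] (X : Scheme.{0}) (f : X ⟶ Spec (.of k)),
    IsSeparated f → LocallyOfFiniteType f → QuasiCompact f → IsIntegral X →
      ∃ (X' : Scheme.{0}) (g : X' ⟶ X), IsProper g ∧ IsIntegral X' ∧ Scheme.IsRegular X' ∧
        Function.Surjective g.base ∧ ∃ U : X.Opens, Dense (U : Set X) ∧ IsFinite (g ∣_ U) ∧
          UniversallyInjective (g ∣_ U)

/-- PICover at `p` (the body of route item `Picover`, stmt-0554, at a fixed `p`): integral finite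
radicial covers of regular integral separated schemes of finite type over fields of
characteristic `p` have resolutions. -/
def PicoverAt (p : ℕ) : Prop :=
  ∀ (k : Type) [Field k] [CharP k p] (Y X : Scheme.{0}) (f : Y ⟶ Spec (.of k)) (g : X ⟶ Y),
    IsSeparated f → LocallyOfFiniteType f → QuasiCompact f → IsIntegral Y → Scheme.IsRegular Y →
      IsIntegral X → IsFinite g → UniversallyInjective g → Function.Surjective g.base →
        Scheme.HasResolution X

/-- Unfolding: the crux is `∀ p prime, PIAlt_p ∧ PICover_p`. [folklore] -/
theorem crux_iff : PalterationThesis ↔ ∀ p : ℕ, p.Prime → PialtAt p ∧ PicoverAt p := Iff.rfl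

/-- The crux is the conjunction of the two cruxes `Pialt` (stmt-0555) and `Picover` (stmt-0554)
of the route: it closes the moment both land, and dies the moment either is refuted. [folklore] -/
theorem crux_iff_pialt_and_picover : PalterationThesis ↔ Pialt ∧ Picover :=
  ⟨fun h => ⟨fun p hp => (h p hp).1, fun p hp => (h p hp).2⟩, fun h p hp => ⟨h.1 p hp, h.2 p hp⟩⟩

/-! ## §1 Position in the implication web: the crux is summit-implied -/

/-- **Resolution in characteristic `p` implies PIAlt_p**: a resolution `π : X̃ → X` of an
integral `X` is proper and surjective, `X̃` is integral and regular, and `π` is finite and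
radicial (indeed an isomorphism) over a dense open (`IsResolution.isPurelyInseparableAlteration`,
Temkin 2013 §1 (i) ⊂ (iii)). [cite: Temkin2013, §1 p. 3 (i), (iii)] -/
theorem pialtAt_of_resolutionInChar {p : ℕ} (h : ResolutionInChar.{0} p) : PialtAt p := by
  intro k _ _ X f hs hl hq hi
  obtain ⟨Y, φ, hφ, hreg⟩ := abramovichOort_of_resolutionInChar h k X f
  obtain ⟨U, hU, hfin, hui⟩ := hφ.exists_dense
  haveI := hφ.surjective
  exact ⟨Y, φ, hφ.isProper, hφ.isIntegral, hreg, φ.surjective, U, hU, hfin, hui⟩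

/-- **Resolution in characteristic `p` implies PICover_p**: the cover `X` is itself a reduced
separated `k`-scheme of finite type (via `g ≫ f`). [folklore] -/
theorem picoverAt_of_resolutionInChar {p : ℕ} (h : ResolutionInChar.{0} p) : PicoverAt p := by
  intro k _ _ Y X f g hs hl hq hiY hreg hiX hfin hui hsurj
  exact h k X (g ≫ f) inferInstance inferInstance inferInstance inferInstance

/-- **The summit implies the crux.** [folklore] -/
theorem crux_of_summit (h : _root_.ResolutionOfSingularities) : PalterationThesis :=
  fun p hp => ⟨pialtAt_of_resolutionInChar (h p hp), picoverAt_of_resolutionInChar (h p hp)⟩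

/-- **A kill of the crux is a counterexample to resolution of singularities in positive
characteristic.** Stated negatively on purpose. [folklore] -/
theorem not_summit_of_not_crux (h : ¬ PalterationThesis) : ¬ _root_.ResolutionOfSingularities :=
  fun hs => h (crux_of_summit hs)

/-- A kill of the crux at a prime `p` is a failure of `ResolutionInChar p`. [folklore] -/
theorem not_resolutionInChar_of_not_cruxAt {p : ℕ} (h : ¬ (PialtAt p ∧ PicoverAt p)) :
    ¬ ResolutionInChar.{0} p :=
  fun hs => h ⟨pialtAt_of_resolutionInChar hs, picoverAt_of_resolutionInChar hs⟩

/-- Route item `Pialt` (stmt-0555) is summit-implied. [folklore] -/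
theorem pialt_of_summit (h : _root_.ResolutionOfSingularities) : Pialt :=
  fun p hp => pialtAt_of_resolutionInChar (h p hp)

/-- Route item `Picover` (stmt-0554) is summit-implied. [folklore] -/
theorem picover_of_summit (h : _root_.ResolutionOfSingularities) : Picover :=
  fun p hp => picoverAt_of_resolutionInChar (h p hp)

/-- Route item `PicoverToRadicialBottom` (stmt-0556) is summit-implied (its conclusion is an
instance of `ResolutionInChar p`). [folklore] -/
theorem picoverToRadicialBottom_of_summit (h : _root_.ResolutionOfSingularities) :
    PicoverToRadicialBottom := by
  intro p hp _ k _ _ X X'' f g hs hl hq hiX _ _ _ _ _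
  exact h p hp k X f hs hl hq inferInstance

/-- Route item `PicoverLocalModel` (stmt-0557) is summit-implied: `Spec ((R[T]/(T^p - a))_red)`
is a reduced affine `k`-scheme of finite type. [folklore] -/
theorem picoverLocalModel_of_summit (h : _root_.ResolutionOfSingularities) :
    PicoverLocalModel := by
  intro p hp k _ _ R _ _ _ hft hreg a
  set A := AdjoinRoot (Polynomial.X ^ p - Polynomial.C a) ⧸
    nilradical (AdjoinRoot (Polynomial.X ^ p - Polynomial.C a)) with hA
  haveI : Algebra.FiniteType k (AdjoinRoot (Polynomial.X ^ p - Polynomial.C a)) :=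
    Algebra.FiniteType.trans (S := R) hft inferInstance
  haveI : Algebra.FiniteType k A := Algebra.FiniteType.trans
    (S := AdjoinRoot (Polynomial.X ^ p - Polynomial.C a)) inferInstance inferInstance
  haveI : _root_.IsReduced A :=
    (Ideal.isRadical_iff_quotient_reduced _).mp (Ideal.radical_isRadical ⊥)
  let f : Spec (.of A) ⟶ Spec (.of k) := Spec.map (CommRingCat.ofHom (algebraMap k A))
  haveI : LocallyOfFiniteType f :=
    (HasRingHomProperty.Spec_iff (P := @LocallyOfFiniteType)).mpr
      (RingHom.finiteType_algebraMap.mpr inferInstance)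
  exact h p hp k (Spec (.of A)) f inferInstance inferInstance inferInstance inferInstance

/-- **Lossless split modulo the assembly frame.** Given the by-name frame `Assembly2`
(stmt-10476: pure assembly, true on paper for every field), the summit is EQUIVALENT to
`crux ∧ PicoverToRadicialBottom` (`DescentReducedToIntegral` being proved in tree): neither
hypothesis of the frame is decoration, and the crux cannot be weakened without losing the summit.
[folklore] -/
theorem summit_iff_crux_and_radicialBottom (hA2 : Assembly2) :
    _root_.ResolutionOfSingularities ↔ PalterationThesis ∧ PicoverToRadicialBottom :=
  ⟨fun h => ⟨crux_of_summit h, picoverToRadicialBottom_of_summit h⟩,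
    fun h => hA2 h.1 h.2 DescentReducedToIntegral_holds⟩

/-! ### §1 bis — inside the route: the local model (stmt-0557) is a special case of PICover -/

section LocalModel

open Polynomial

variable {R : Type} [CommRing R] (f : R[X])

/-- **`Spec (R[T]/(f))_red → Spec R` is universally injective when the class of `T` is a
`p`-th root of an element of `R`, `char R = p`** (`R` a domain): a ring map out of
`(R[T]/(f))_red` to a field `K` is determined by its restriction to `R`, the image of `T` being
the unique `p`-th root of the image of `a` (Frobenius is injective on `K`, of characteristic
`p`). [folklore] -/
theorem universallyInjective_adjoinRoot_red [IsDomain R] {p : ℕ} [Fact p.Prime] [CharP R p]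
    {a : R} (hfa : AdjoinRoot.root f ^ p = AdjoinRoot.of f a) :
    UniversallyInjective (Spec.map (CommRingCat.ofHom
      ((Ideal.Quotient.mk (nilradical (AdjoinRoot f))).comp (AdjoinRoot.of f)))) := by
  refine ((tfae_universallyInjective _).out 0 1).mpr ?_
  intro K _ g₁ g₂ h
  obtain ⟨φ₁, rfl⟩ := Spec.map_surjective g₁
  obtain ⟨φ₂, rfl⟩ := Spec.map_surjective g₂
  simp only [← Spec.map_comp] at h
  have h' := congrArg (fun ψ => ψ.hom) (Spec.map_injective h)
  simp only [CommRingCat.hom_comp, CommRingCat.hom_ofHom] at h'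
  have h'' : ∀ r : R, φ₁.hom (Ideal.Quotient.mk _ (AdjoinRoot.of f r)) =
      φ₂.hom (Ideal.Quotient.mk _ (AdjoinRoot.of f r)) := fun r =>
    congrFun (congrArg DFunLike.coe h') r
  haveI : CharP K p := CharP.of_ringHom_of_ne_zero
    (φ₁.hom.comp ((Ideal.Quotient.mk (nilradical (AdjoinRoot f))).comp (AdjoinRoot.of f))) p
    (Fact.out : p.Prime).ne_zero
  have hval : φ₁.hom (Ideal.Quotient.mk _ (AdjoinRoot.root f)) =
      φ₂.hom (Ideal.Quotient.mk _ (AdjoinRoot.root f)) := by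
    apply (frobenius K p).injective
    simp only [frobenius_def]
    rw [← map_pow, ← map_pow, ← map_pow, ← map_pow, hfa]
    exact h'' a
  have hφ : φ₁.hom = φ₂.hom := by
    apply Ideal.Quotient.ringHom_ext
    apply Ideal.Quotient.ringHom_ext
    refine Polynomial.ringHom_ext (fun r => ?_) ?_
    · exact h'' r
    · exact hval
  congr 1
  ext1
  exact hφ

/-- `Spec (R[T]/(f))_red → Spec R` is finite for `f` monic: a closed immersion (nilpotent
thickening) followed by the finite free `Spec R[T]/(f) → Spec R`. [folklore] -/
theorem isFinite_adjoinRoot_red (hf : f.Monic) :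
    IsFinite (Spec.map (CommRingCat.ofHom
      ((Ideal.Quotient.mk (nilradical (AdjoinRoot f))).comp (AdjoinRoot.of f)))) := by
  haveI : Module.Finite R (AdjoinRoot f) := hf.finite_adjoinRoot
  haveI : IsFinite (Spec.map (CommRingCat.ofHom (algebraMap R (AdjoinRoot f)))) := by
    rw [IsFinite.SpecMap_iff]
    exact RingHom.finite_algebraMap.mpr inferInstance
  haveI : IsClosedImmersion (Spec.map (CommRingCat.ofHom (Ideal.Quotient.mk (nilradical (AdjoinRoot f))))) :=
    IsClosedImmersion.spec_of_surjective _ Ideal.Quotient.mk_surjective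
  rw [CommRingCat.ofHom_comp, Spec.map_comp]
  exact MorphismProperty.comp_mem _ _ _ inferInstance ‹_›

/-- `Spec (R[T]/(f))_red → Spec R` is surjective for `f` monic of positive degree (a nilpotent
thickening followed by a finite map with injective ring homomorphism: lying over). [folklore] -/
theorem surjective_adjoinRoot_red [IsDomain R] (hf : f.Monic) (hdeg : f.degree ≠ 0) :
    Function.Surjective (Spec.map (CommRingCat.ofHom
      ((Ideal.Quotient.mk (nilradical (AdjoinRoot f))).comp (AdjoinRoot.of f)))).base := by
  haveI : Module.Finite R (AdjoinRoot f) := hf.finite_adjoinRoot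
  haveI : FaithfulSMul R (AdjoinRoot f) :=
    (faithfulSMul_iff_algebraMap_injective _ _).mpr (AdjoinRoot.of.injective_of_degree_ne_zero hdeg)
  have h1 : Function.Surjective (Spec.map (CommRingCat.ofHom (algebraMap R (AdjoinRoot f)))).base := by
    intro y
    obtain ⟨x, hx⟩ := Algebra.IsIntegral.comap_surjective R (AdjoinRoot f) y
    exact ⟨x, hx⟩
  have h2 : Function.Surjective
      (Spec.map (CommRingCat.ofHom (Ideal.Quotient.mk (nilradical (AdjoinRoot f))))).base := by
    intro y
    let y' : PrimeSpectrum (AdjoinRoot f) := y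
    refine ⟨⟨y'.asIdeal.map (Ideal.Quotient.mk _), ?_⟩, ?_⟩
    · exact Ideal.map_isPrime_of_surjective Ideal.Quotient.mk_surjective
        (by rw [Ideal.mk_ker]; exact nilradical_le_prime y'.asIdeal)
    · apply PrimeSpectrum.ext
      change Ideal.comap (Ideal.Quotient.mk _) (y'.asIdeal.map (Ideal.Quotient.mk _)) = y'.asIdeal
      rw [Ideal.comap_map_of_surjective _ Ideal.Quotient.mk_surjective]
      refine sup_eq_left.mpr ?_
      intro x hx
      exact nilradical_le_prime y'.asIdeal (Ideal.Quotient.eq_zero_iff_mem.mp (by simpa using hx))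
  rw [CommRingCat.ofHom_comp, Spec.map_comp]
  intro y
  obtain ⟨z, rfl⟩ := h1 y
  obtain ⟨w, rfl⟩ := h2 z
  exact ⟨w, by simp⟩

end LocalModel

/-- **The local model (stmt-0557) is a special case of PICover (stmt-0554)**, formally: given
PICover in the (equivalent, `picover_iff_reducedX`) form with `IsReduced X`, the reduced scheme
`Spec (R[T]/(T^p - a))_red` is a finite, universally injective, surjective cover of the regular
integral affine `Spec R` (`R` a regular finitely generated `k`-domain, `char k = p`). [folklore] -/
theorem picoverLocalModel_of_picoverReduced
    (h : ∀ p : ℕ, p.Prime → ∀ (k : Type) [Field k] [CharP k p] (Y X : Scheme.{0})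
      (f : Y ⟶ Spec (.of k)) (g : X ⟶ Y), IsSeparated f → LocallyOfFiniteType f →
        QuasiCompact f → IsIntegral Y → Scheme.IsRegular Y → IsReduced X → IsFinite g →
          UniversallyInjective g → Function.Surjective g.base → Scheme.HasResolution X) :
    PicoverLocalModel := by
  intro p hpr k _ _ R _ _ _ hft hreg a
  haveI : Fact p.Prime := ⟨hpr⟩
  haveI := hreg
  haveI : CharP R p := charP_of_injective_algebraMap (algebraMap k R).injective p
  set F : Polynomial R := Polynomial.X ^ p - Polynomial.C a with hF
  haveI : _root_.IsReduced (AdjoinRoot F ⧸ nilradical (AdjoinRoot F)) :=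
    (Ideal.isRadical_iff_quotient_reduced _).mp (Ideal.radical_isRadical ⊥)
  have hmonic : F.Monic := Polynomial.monic_X_pow_sub_C a hpr.ne_zero
  have hdeg : F.degree ≠ 0 := by
    rw [hF, Polynomial.degree_X_pow_sub_C hpr.pos]
    exact_mod_cast hpr.ne_zero
  have hroot : AdjoinRoot.root F ^ p = AdjoinRoot.of F a := by
    have := AdjoinRoot.eval₂_root F
    rw [hF, Polynomial.eval₂_sub, Polynomial.eval₂_X_pow, Polynomial.eval₂_C] at this
    rw [hF]
    exact sub_eq_zero.mp this
  let f : Spec (.of R) ⟶ Spec (.of k) := Spec.map (CommRingCat.ofHom (algebraMap k R))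
  haveI : LocallyOfFiniteType f :=
    (HasRingHomProperty.Spec_iff (P := @LocallyOfFiniteType)).mpr
      (RingHom.finiteType_algebraMap.mpr hft)
  exact h p hpr k (Spec (.of R)) _ f _ inferInstance inferInstance inferInstance
    inferInstance (Scheme.isRegular_Spec (.of R)) inferInstance (isFinite_adjoinRoot_red F hmonic)
    (universallyInjective_adjoinRoot_red F hroot) (surjective_adjoinRoot_red F hmonic hdeg)

/-- **`Picover → PicoverLocalModel`** (stmt-0554 ⇒ stmt-0557): the rank-5 local model is
REDUNDANT given the rank-2 crux (via `picover_iff_reducedX`, proved in §3 below, restated here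
to keep §1 self-contained: a finite radicial surjection onto an integral scheme from a reduced
scheme has integral source). Information for the planner. [folklore] -/
theorem picoverLocalModel_of_picover (h : Picover) : PicoverLocalModel := by
  refine picoverLocalModel_of_picoverReduced fun p hp k _ _ Y X f g hs hl hq hiY hreg hred hfin hui hsurj => ?_
  have hhomeo : IsHomeomorph g.base :=
    isHomeomorph_iff_continuous_isClosedMap_bijective.mpr
      ⟨g.continuous, g.isClosedMap, g.injective, hsurj⟩
  haveI : IrreducibleSpace X := (hhomeo.homeomorph).irreducibleSpace_iff.mpr inferInstance
  haveI : IsIntegral X := isIntegral_of_irreducibleSpace_of_isReduced X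
  exact h p hp k Y X f g hs hl hq hiY hreg inferInstance hfin hui hsurj

/-! ## §2 PIAlt: load-bearing hypotheses -/

/-- **PIAlt with `IsIntegral X` dropped fails at the EMPTY scheme** (junk witness: an integral
`X'` is non-empty and cannot map to `∅`). [folklore] -/
theorem pialt_false_without_isIntegral_empty (p : ℕ) [Fact p.Prime] :
    ¬ ∀ (k : Type) [Field k] [CharP k p] (X : Scheme.{0}) (f : X ⟶ Spec (.of k)),
        IsSeparated f → LocallyOfFiniteType f → QuasiCompact f →
          ∃ (X' : Scheme.{0}) (g : X' ⟶ X), IsProper g ∧ IsIntegral X' ∧ Scheme.IsRegular X' ∧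
            Function.Surjective g.base ∧ ∃ U : X.Opens, Dense (U : Set X) ∧ IsFinite (g ∣_ U) ∧
              UniversallyInjective (g ∣_ U) := by
  intro h
  obtain ⟨X', g, -, hint, -⟩ := h (ZMod p) (∅ : Scheme.{0}) (Scheme.emptyTo _) inferInstance
    inferInstance inferInstance
  obtain ⟨x⟩ := hint.nonempty
  exact isEmptyElim (g.base x)

/-- `K × K` is not a domain. [folklore] -/
theorem not_isDomain_prod (K : Type) [Field K] : ¬ IsDomain (K × K) := by
  intro h
  have : ((1, 0) : K × K) * (0, 1) = 0 := by simp
  rcases mul_eq_zero.mp this with h1 | h1 <;> simp at h1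

/-- **PIAlt with `IsIntegral X` weakened to `IsReduced X ∧ Nonempty X` fails at
`Spec (𝔽_p × 𝔽_p)`** (two points, affine of finite type over `𝔽_p`): the image of the integral
`X'` under the surjection `g` would be irreducible, making `Spec (𝔽_p × 𝔽_p)` integral, i.e.
`𝔽_p × 𝔽_p` a domain. IRREDUCIBILITY of `X` is what PIAlt uses. [folklore] -/
theorem pialt_false_without_irreducible (p : ℕ) [Fact p.Prime] :
    ¬ ∀ (k : Type) [Field k] [CharP k p] (X : Scheme.{0}) (f : X ⟶ Spec (.of k)),
        IsSeparated f → LocallyOfFiniteType f → QuasiCompact f → IsReduced X → Nonempty X →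
          ∃ (X' : Scheme.{0}) (g : X' ⟶ X), IsProper g ∧ IsIntegral X' ∧ Scheme.IsRegular X' ∧
            Function.Surjective g.base ∧ ∃ U : X.Opens, Dense (U : Set X) ∧ IsFinite (g ∣_ U) ∧
              UniversallyInjective (g ∣_ U) := by
  intro h
  let f : Spec (.of (ZMod p × ZMod p)) ⟶ Spec (.of (ZMod p)) :=
    Spec.map (CommRingCat.ofHom (algebraMap (ZMod p) (ZMod p × ZMod p)))
  haveI : LocallyOfFiniteType f :=
    (HasRingHomProperty.Spec_iff (P := @LocallyOfFiniteType)).mpr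
      (RingHom.finiteType_algebraMap.mpr inferInstance)
  haveI : Nonempty (Spec (.of (ZMod p × ZMod p))) :=
    ⟨⟨Ideal.comap (RingHom.fst (ZMod p) (ZMod p)) ⊥, Ideal.comap_isPrime _ _⟩⟩
  obtain ⟨X', g, -, hint, -, hsurj, -⟩ := h (ZMod p) (Spec (.of (ZMod p × ZMod p))) f
    inferInstance inferInstance inferInstance inferInstance inferInstance
  haveI : IrreducibleSpace (Spec (.of (ZMod p × ZMod p))) :=
    hsurj.irreducibleSpace g.base.hom.continuous
  have hi : IsIntegral (Spec (.of (ZMod p × ZMod p))) :=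
    isIntegral_of_irreducibleSpace_of_isReduced _
  exact not_isDomain_prod (ZMod p) ((affine_isIntegral_iff (.of (ZMod p × ZMod p))).mp hi)

open Scheme.IdealSheafData in
/-- **Reducedness of `X` is NOT load-bearing in PIAlt; irreducibility is the whole of
`IsIntegral X`.** PIAlt at `p` is equivalent to its version for IRREDUCIBLE (possibly
non-reduced) `X`: compose a purely inseparable regular alteration of `X_red` (the reduced closed
subscheme on `⊤`, integral) with the closed immersion `X_red → X`, which is finite, radicial and a
homeomorphism. [folklore] -/
theorem pialt_iff_irreducible (p : ℕ) :
    (∀ (k : Type) [Field k] [CharP k p] (X : Scheme.{0}) (f : X ⟶ Spec (.of k)),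
        IsSeparated f → LocallyOfFiniteType f → QuasiCompact f → IsIntegral X →
          ∃ (X' : Scheme.{0}) (g : X' ⟶ X), IsProper g ∧ IsIntegral X' ∧ Scheme.IsRegular X' ∧
            Function.Surjective g.base ∧ ∃ U : X.Opens, Dense (U : Set X) ∧ IsFinite (g ∣_ U) ∧
              UniversallyInjective (g ∣_ U)) ↔
    (∀ (k : Type) [Field k] [CharP k p] (X : Scheme.{0}) (f : X ⟶ Spec (.of k)),
        IsSeparated f → LocallyOfFiniteType f → QuasiCompact f → IrreducibleSpace X →
          ∃ (X' : Scheme.{0}) (g : X' ⟶ X), IsProper g ∧ IsIntegral X' ∧ Scheme.IsRegular X' ∧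
            Function.Surjective g.base ∧ ∃ U : X.Opens, Dense (U : Set X) ∧ IsFinite (g ∣_ U) ∧
              UniversallyInjective (g ∣_ U)) := by
  refine ⟨fun h k _ _ X f hs hl hq hirr => ?_, fun h k _ _ X f hs hl hq hi => h k X f hs hl hq inferInstance⟩
  -- the reduced structure on `X`
  let ι := (vanishingIdeal (⊤ : Closeds X)).subschemeι
  haveI hint : IsIntegral (vanishingIdeal (⊤ : Closeds X)).subscheme :=
    isIntegral_subscheme_vanishingIdeal ⊤ (by
      simpa using IrreducibleSpace.isIrreducible_univ X)
  obtain ⟨X', g', hg', hint', hreg', hsurj', U', hU', hfin', hui'⟩ :=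
    h k _ (ι ≫ f) inferInstance inferInstance inferInstance hint
  haveI := hg'
  -- `ι` is a surjective closed immersion, hence a homeomorphism
  have hrange : Set.range ι = (Set.univ : Set X) := by
    have h1 := range_subschemeι_vanishingIdeal (X := X) (⊤ : Closeds X)
    rw [TopologicalSpace.Closeds.coe_top] at h1
    exact h1
  have hιsurj : Function.Surjective ι.base := Set.range_eq_univ.mp hrange
  have hhomeo : IsHomeomorph ι.base :=
    isHomeomorph_iff_continuous_isClosedMap_bijective.mpr
      ⟨ι.continuous, ι.isClosedMap, ι.isClosedEmbedding.injective, hιsurj⟩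
  let U : X.Opens := ⟨ι.base '' (U' : Set _), hhomeo.isOpenMap _ U'.isOpen⟩
  have hUpre : ι ⁻¹ᵁ U = U' := by
    ext1
    exact Set.preimage_image_eq _ ι.isClosedEmbedding.injective
  refine ⟨X', g' ≫ ι, inferInstance, hint', hreg', ?_, U, ?_, ?_, ?_⟩
  · intro x
    obtain ⟨y, rfl⟩ := hιsurj x
    obtain ⟨z, rfl⟩ := hsurj' y
    exact ⟨z, by simp⟩
  · refine U.isOpen.dense ?_
    obtain ⟨y, hy⟩ := hU'.nonempty
    exact ⟨ι.base y, y, hy, rfl⟩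
  · have hfinU : IsFinite (g' ∣_ ι ⁻¹ᵁ U) := by rw [hUpre]; exact hfin'
    have hfinι : IsFinite (ι ∣_ U) := inferInstance
    rw [morphismRestrict_comp]
    exact MorphismProperty.comp_mem _ _ _ hfinU hfinι
  · have huiU : UniversallyInjective (g' ∣_ ι ⁻¹ᵁ U) := by rw [hUpre]; exact hui'
    have huiι : UniversallyInjective (ι ∣_ U) := MorphismProperty.of_isPullback
      (isPullback_morphismRestrict ι U).flip inferInstance
    rw [morphismRestrict_comp]
    exact MorphismProperty.comp_mem _ _ _ huiU huiι

/-- In a ring in which every element is an `n`-th power, every element of a prime `Q` is, for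
every `k`, an `n ^ k`-th power of an element of `Q`. [folklore] -/
theorem exists_pow_pow_eq_of_mem {R : Type*} [CommRing R] {n : ℕ}
    (hpow : ∀ a : R, ∃ b : R, b ^ n = a) (Q : Ideal R) [Q.IsPrime] {r : R} (hr : r ∈ Q) (k : ℕ) :
    ∃ b ∈ Q, b ^ (n ^ k) = r := by
  induction k with
  | zero => exact ⟨r, hr, by simp⟩
  | succ k ih =>
    obtain ⟨b, hbQ, hb⟩ := ih
    obtain ⟨c, hc⟩ := hpow b
    refine ⟨c, ‹Q.IsPrime›.mem_of_pow_mem n (hc ▸ hbQ), ?_⟩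
    rw [pow_succ, pow_mul', hc, hb]

/-- **No integral scheme with Noetherian stalks surjects onto the spectrum of a root-closed
domain that is not a field.** If every element of the domain `R` is an `n`-th power (`n ≥ 2`)
and `Q ≠ 0` is a prime of `R`, there is no `g : X' → Spec R` with `X'` INTEGRAL, all stalks
`𝒪_{X',x}` Noetherian (e.g. `X'` regular) and `g` surjective: `θ : R → Γ(X') → 𝒪_{X',x₁}`
(`x₁ ↦ Q`) is the local stalk map after the germ map, so it sends `Q` into the maximal ideal
`𝔪`, hence — every `r ∈ Q` being a `n^k`-th power of an element of `Q` for all `k` — into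
`⋂ₖ 𝔪^k = 0` (Krull, `Ideal.iInf_pow_eq_bot_of_isLocalRing`); so the global section of a
non-zero `r ∈ Q` vanishes (germs of an integral scheme are injective,
`germ_injective_of_isIntegral`); but at a point `x₀` over the generic point its germ is a unit.
Properness or finiteness of `g` is not used. [folklore] -/
theorem false_of_surjective_of_forall_exists_pow_eq (R : Type) [CommRing R] [IsDomain R]
    {n : ℕ} (hn : 2 ≤ n) (hpow : ∀ a : R, ∃ b : R, b ^ n = a)
    {Q : Ideal R} [hQ : Q.IsPrime] (hQne : Q ≠ ⊥)
    {X' : Scheme.{0}} [IsIntegral X'] (g : X' ⟶ Spec (.of R))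
    (hnoeth : ∀ x : X', IsNoetherianRing (X'.presheaf.stalk x))
    (hsurj : Function.Surjective g.base) : False := by
  -- points over `Q` and over the generic point
  obtain ⟨x₁, hx₁⟩ := hsurj ⟨Q, hQ⟩
  obtain ⟨x₀, hx₀⟩ := hsurj ⟨⊥, Ideal.isPrime_bot⟩
  obtain ⟨r, hrQ, hr0⟩ := Submodule.exists_mem_ne_zero_of_ne_bot hQne
  -- the ring maps `θ x : R → 𝒪_{X',x}`
  let sec : R → Γ(X', ⊤) := fun t => g.appTop ((Scheme.ΓSpecIso (.of R)).inv t)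
  let θ : ∀ x : X', R →+* X'.presheaf.stalk x := fun x =>
    (X'.presheaf.germ ⊤ x trivial).hom.comp (g.appTop.hom.comp (Scheme.ΓSpecIso (.of R)).inv.hom)
  have hθ : ∀ (x : X') (t : R), θ x t = X'.presheaf.germ ⊤ x trivial (sec t) := fun x t => rfl
  -- naturality: `θ x t` is the image under the (local) stalk map of the germ of `t` at `g x`
  have hnat : ∀ (x : X') (t : R), θ x t =
      g.stalkMap x ((Spec (.of R)).presheaf.germ ⊤ (g.base x) trivial
        ((Scheme.ΓSpecIso (.of R)).inv t)) := by
    intro x t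
    rw [hθ, Scheme.Hom.germ_stalkMap_apply]
    rfl
  -- units: the germ of `t` at `g x` is a unit iff `t ∉ (g x).asIdeal`
  have hunit : ∀ (x : X') (t : R),
      IsUnit ((Spec (.of R)).presheaf.germ ⊤ (g.base x) trivial
        ((Scheme.ΓSpecIso (.of R)).inv t)) ↔ t ∉ (g.base x).asIdeal := by
    intro x t
    rw [← Scheme.mem_basicOpen_top, basicOpen_eq_of_affine]
    exact PrimeSpectrum.mem_basicOpen t (g.base x)
  -- (1) `θ x₁` sends `Q` into the maximal ideal, hence `r` into `⋂ 𝔪^k = ⊥`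
  have hmax : ∀ t ∈ Q, θ x₁ t ∈ IsLocalRing.maximalIdeal (X'.presheaf.stalk x₁) := by
    intro t ht
    rw [IsLocalRing.mem_maximalIdeal, mem_nonunits_iff, hnat, isUnit_map_iff, hunit, hx₁]
    exact not_not.mpr ht
  have hzero : θ x₁ r = 0 := by
    haveI := hnoeth x₁
    have hmem : θ x₁ r ∈ ⨅ k : ℕ, IsLocalRing.maximalIdeal (X'.presheaf.stalk x₁) ^ k := by
      refine Ideal.mem_iInf.mpr fun k => ?_
      obtain ⟨b, hbQ, hb⟩ := exists_pow_pow_eq_of_mem hpow Q hrQ k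
      rw [← hb, map_pow]
      have hk : k ≤ n ^ k := (Nat.lt_pow_self (by omega)).le
      exact Ideal.pow_le_pow_right hk (Ideal.pow_mem_pow (hmax b hbQ) _)
    rwa [Ideal.iInf_pow_eq_bot_of_isLocalRing _ (IsLocalRing.maximalIdeal.isMaximal _).ne_top,
      Ideal.mem_bot] at hmem
  -- (2) hence the global section `sec r` vanishes (germs of an integral scheme are injective)
  have hsec : sec r = 0 := by
    apply germ_injective_of_isIntegral (X := X') x₁ (U := ⊤) trivial
    rw [← hθ, hzero, map_zero]
  -- (3) but at `x₀`, over the generic point, the germ of `r ≠ 0` is a unit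
  have hu : IsUnit (θ x₀ r) := by
    rw [hnat]
    exact ((hunit x₀ r).mpr (by rw [hx₀]; simpa using hr0)).map _
  rw [hθ, hsec, map_zero] at hu
  exact not_isUnit_zero hu

/-- **PIAlt with `LocallyOfFiniteType f` dropped is FALSE at every prime**, for a reason cruder
than resolution: NO integral regular scheme surjects onto `X = Spec 𝔽_p[T]⁺` (the absolute
integral closure of the affine line: affine — separated, quasi-compact — and integral over `𝔽_p`;
every element a square, `absoluteIntegralClosure_exists_sq_eq`; generic point not open,
`absoluteIntegralClosure_exists_prime_not_mem`). Any proof of PIAlt must use the finite type of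
`X`. [folklore] -/
theorem pialt_false_without_locallyOfFiniteType_at (p : ℕ) [Fact p.Prime] :
    ¬ ∀ (k : Type) [Field k] [CharP k p] (X : Scheme.{0}) (f : X ⟶ Spec (.of k)),
        IsSeparated f → QuasiCompact f → IsIntegral X →
          ∃ (X' : Scheme.{0}) (g : X' ⟶ X), IsProper g ∧ IsIntegral X' ∧ Scheme.IsRegular X' ∧
            Function.Surjective g.base ∧ ∃ U : X.Opens, Dense (U : Set X) ∧ IsFinite (g ∣_ U) ∧
              UniversallyInjective (g ∣_ U) := by
  intro h
  let R := ↥(integralClosure (Polynomial (ZMod p)) (AlgebraicClosure (RatFunc (ZMod p))))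
  let f : Spec (.of R) ⟶ Spec (.of (ZMod p)) :=
    Spec.map (CommRingCat.ofHom ((algebraMap (Polynomial (ZMod p)) R).comp Polynomial.C))
  obtain ⟨X', g, -, hint, hreg, hsurj, -⟩ := h (ZMod p) (Spec (.of R)) f inferInstance
    inferInstance inferInstance
  obtain ⟨Q, hQ, hQne, -⟩ := absoluteIntegralClosure_exists_prime_not_mem p (1 : R) one_ne_zero
  haveI := hQ
  exact false_of_surjective_of_forall_exists_pow_eq R le_rfl (absoluteIntegralClosure_exists_sq_eq p)
    hQne g (fun x => by haveI := hreg x; infer_instance) hsurj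

/-- The crux-level form: PIAlt-without-finite-type for all primes is false (already `p = 2`).
[folklore] -/
theorem pialt_false_without_locallyOfFiniteType :
    ¬ ∀ p : ℕ, p.Prime → ∀ (k : Type) [Field k] [CharP k p] (X : Scheme.{0})
        (f : X ⟶ Spec (.of k)), IsSeparated f → QuasiCompact f → IsIntegral X →
          ∃ (X' : Scheme.{0}) (g : X' ⟶ X), IsProper g ∧ IsIntegral X' ∧ Scheme.IsRegular X' ∧
            Function.Surjective g.base ∧ ∃ U : X.Opens, Dense (U : Set X) ∧ IsFinite (g ∣_ U) ∧
              UniversallyInjective (g ∣_ U) := fun h =>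
  haveI : Fact (Nat.Prime 2) := ⟨Nat.prime_two⟩
  pialt_false_without_locallyOfFiniteType_at 2 (h 2 Nat.prime_two)

/-- PIAlt at `p` with `IsSeparated f` DROPPED (status: open, contains PIAlt_p; no junk model). -/
def PialtWithoutSeparatedAt (p : ℕ) : Prop :=
  ∀ (k : Type) [Field k] [CharP k p] (X : Scheme.{0}) (f : X ⟶ Spec (.of k)),
    LocallyOfFiniteType f → QuasiCompact f → IsIntegral X →
      ∃ (X' : Scheme.{0}) (g : X' ⟶ X), IsProper g ∧ IsIntegral X' ∧ Scheme.IsRegular X' ∧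
        Function.Surjective g.base ∧ ∃ U : X.Opens, Dense (U : Set X) ∧ IsFinite (g ∣_ U) ∧
          UniversallyInjective (g ∣_ U)

/-- The trivial direction, contrapositively. [folklore] -/
theorem not_pialtWithoutSeparated_of_not {p : ℕ} (h : ¬ PialtAt p) : ¬ PialtWithoutSeparatedAt p :=
  fun h' => h fun k _ _ X f _ hl hq hi => h' k X f hl hq hi

/-- PIAlt at `p` with `QuasiCompact f` DROPPED (status: open, contains PIAlt_p; no junk model). -/
def PialtWithoutQuasiCompactAt (p : ℕ) : Prop :=
  ∀ (k : Type) [Field k] [CharP k p] (X : Scheme.{0}) (f : X ⟶ Spec (.of k)),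
    IsSeparated f → LocallyOfFiniteType f → IsIntegral X →
      ∃ (X' : Scheme.{0}) (g : X' ⟶ X), IsProper g ∧ IsIntegral X' ∧ Scheme.IsRegular X' ∧
        Function.Surjective g.base ∧ ∃ U : X.Opens, Dense (U : Set X) ∧ IsFinite (g ∣_ U) ∧
          UniversallyInjective (g ∣_ U)

/-- The trivial direction, contrapositively. [folklore] -/
theorem not_pialtWithoutQuasiCompact_of_not {p : ℕ} (h : ¬ PialtAt p) :
    ¬ PialtWithoutQuasiCompactAt p :=
  fun h' => h fun k _ _ X f hs hl _ hi => h' k X f hs hl hi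

/-! ### §2 bis — PIAlt: the radiciality clause is the whole open content -/

/-- de Jong's regular-alteration statement in characteristic `p` (universe 0; the body of the
named fact `DeJong1996` restricted to fields of characteristic `p`). -/
def DeJongAt (p : ℕ) : Prop :=
  ∀ (k : Type) [Field k] [CharP k p] (X : Scheme.{0}) (f : X ⟶ Spec (.of k)),
    IsSeparated f → LocallyOfFiniteType f → QuasiCompact f → IsIntegral X →
      ∃ (X₁ : Scheme.{0}) (φ : X₁ ⟶ X), IsAlteration φ ∧ Scheme.IsRegular X₁

/-- `DeJong1996` gives `DeJongAt p` for every `p`. [cite: DeJong1996, Thm. 4.1, p. 66] -/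
theorem deJongAt_of_deJong1996 (h : DeJong1996.{0}) (p : ℕ) : DeJongAt p :=
  fun k _ _ X f hs hl hq hi => h k X f hs hl hq hi

/-- PIAlt at `p` with the radiciality clause `UniversallyInjective (g ∣_ U)` DROPPED from the
conclusion. -/
def PialtWithoutUIAt (p : ℕ) : Prop :=
  ∀ (k : Type) [Field k] [CharP k p] (X : Scheme.{0}) (f : X ⟶ Spec (.of k)),
    IsSeparated f → LocallyOfFiniteType f → QuasiCompact f → IsIntegral X →
      ∃ (X' : Scheme.{0}) (g : X' ⟶ X), IsProper g ∧ IsIntegral X' ∧ Scheme.IsRegular X' ∧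
        Function.Surjective g.base ∧ ∃ U : X.Opens, Dense (U : Set X) ∧ IsFinite (g ∣_ U)

/-- **Dropping radiciality from PIAlt's conclusion gives EXACTLY de Jong's statement** in
characteristic `p` (surjective + proper = dominant + proper; dense = non-empty for opens of an
irreducible space). [folklore] -/
theorem pialtWithoutUIAt_iff_deJongAt (p : ℕ) : PialtWithoutUIAt p ↔ DeJongAt p := by
  constructor
  · intro h k _ _ X f hs hl hq hi
    obtain ⟨X', g, hg, hint, hreg, hsurj, U, hU, hfin⟩ := h k X f hs hl hq hi
    exact ⟨X', g, ⟨hint, hg, ⟨hsurj.denseRange⟩, U, hU.nonempty, hfin⟩, hreg⟩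
  · intro h k _ _ X f hs hl hq hi
    obtain ⟨X₁, φ, hφ, hreg⟩ := h k X f hs hl hq hi
    obtain ⟨U, hU, hfin⟩ := hφ.exists_isFinite
    haveI := hφ.surjective
    exact ⟨X₁, φ, hφ.isProper, hφ.isIntegral, hreg, φ.surjective, U, U.isOpen.dense hU, hfin⟩

/-- **Modulo the named fact `DeJong1996` (a theorem in print), PIAlt without radiciality HOLDS at
every `p`**: the clause `UniversallyInjective (g ∣_ U)` carries the entire open content of PIAlt.
[cite: DeJong1996, Thm. 4.1, p. 66] -/
theorem pialtWithoutUIAt_of_deJong1996 (h : DeJong1996.{0}) (p : ℕ) : PialtWithoutUIAt p :=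
  (pialtWithoutUIAt_iff_deJongAt p).mpr (deJongAt_of_deJong1996 h p)

/-- PIAlt_p implies de Jong's statement at `p` (forget radiciality). [folklore] -/
theorem deJongAt_of_pialtAt {p : ℕ} (h : PialtAt p) : DeJongAt p :=
  (pialtWithoutUIAt_iff_deJongAt p).mp fun k _ _ X f hs hl hq hi => by
    obtain ⟨X', g, hg, hint, hreg, hsurj, U, hU, hfin, -⟩ := h k X f hs hl hq hi
    exact ⟨X', g, hg, hint, hreg, hsurj, U, hU, hfin⟩

/-! ## §3 PICover: load-bearing hypotheses -/

/-- `Spec K[ε] → Spec K` is universally injective (radicial): a `K'`-point of `Spec K[ε]` kills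
`ε`, so it is determined by its composite with the structure map (`K`-points criterion,
`tfae_universallyInjective`, Stacks 01S4). [folklore] -/
theorem universallyInjective_spec_dualNumber (K : Type) [Field K] :
    UniversallyInjective
      (Spec.map (CommRingCat.ofHom (algebraMap K (DualNumber K)))) := by
  refine ((tfae_universallyInjective
    (Spec.map (CommRingCat.ofHom (algebraMap K (DualNumber K))))).out 0 1).mpr ?_
  intro L _ g₁ g₂ h
  obtain ⟨φ₁, rfl⟩ := Spec.map_surjective g₁
  obtain ⟨φ₂, rfl⟩ := Spec.map_surjective g₂
  simp only [← Spec.map_comp] at h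
  have h' := Spec.map_injective h
  have hε : ∀ (φ : CommRingCat.of (DualNumber K) ⟶ CommRingCat.of L), φ.hom DualNumber.eps = 0 := by
    intro φ
    have : (φ.hom DualNumber.eps) ^ 2 = 0 := by
      rw [← map_pow, pow_two, DualNumber.eps_mul_eps, map_zero]
    exact (pow_eq_zero_iff two_ne_zero).mp this
  congr 1
  ext1
  refine DualNumber.ringHom_ext ?_ ?_
  · have := congrArg (fun ψ => ψ.hom) h'
    simpa using this
  · rw [hε φ₁, hε φ₂]

/-- **PICover with `IsIntegral X` dropped is FALSE at every prime.** Witness: `Y = Spec 𝔽_p`,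
`X = Spec 𝔽_p[ε]`, `g` the structure map (finite, radicial, surjective onto the point);
`Spec 𝔽_p[ε]` has no resolution (`not_hasResolution_spec_dualNumber`). Any proof of PICover
must use reducedness of `X`. [folklore] -/
theorem picover_false_without_isIntegralX_at (p : ℕ) [Fact p.Prime] :
    ¬ ∀ (k : Type) [Field k] [CharP k p] (Y X : Scheme.{0}) (f : Y ⟶ Spec (.of k)) (g : X ⟶ Y),
        IsSeparated f → LocallyOfFiniteType f → QuasiCompact f → IsIntegral Y →
          Scheme.IsRegular Y → IsFinite g → UniversallyInjective g →
            Function.Surjective g.base → Scheme.HasResolution X := by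
  intro h
  haveI : Module.Finite (ZMod p) (DualNumber (ZMod p)) :=
    inferInstanceAs (Module.Finite (ZMod p) (ZMod p × ZMod p))
  let g : Spec (.of (DualNumber (ZMod p))) ⟶ Spec (.of (ZMod p)) :=
    Spec.map (CommRingCat.ofHom (algebraMap (ZMod p) (DualNumber (ZMod p))))
  haveI : IsFinite g := by
    rw [IsFinite.SpecMap_iff]
    exact RingHom.finite_algebraMap.mpr inferInstance
  haveI : UniversallyInjective g := universallyInjective_spec_dualNumber (ZMod p)
  have hsurj : Function.Surjective g.base := by
    intro y
    refine ⟨⟨Ideal.comap (TrivSqZeroExt.fstHom (ZMod p) (ZMod p) (ZMod p)).toRingHom ⊥, ?_⟩, ?_⟩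
    · exact Ideal.comap_isPrime _ _
    · exact Subsingleton.elim _ _
  exact not_hasResolution_spec_dualNumber (ZMod p)
    (h (ZMod p) (Spec (.of (ZMod p))) (Spec (.of (DualNumber (ZMod p)))) (𝟙 _) g inferInstance
      inferInstance inferInstance inferInstance (Scheme.isRegular_Spec (.of (ZMod p)))
      inferInstance inferInstance hsurj)

/-- The crux-level form: PICover-without-`IsIntegral X` for all primes is false. [folklore] -/
theorem picover_false_without_isIntegralX :
    ¬ ∀ p : ℕ, p.Prime → ∀ (k : Type) [Field k] [CharP k p] (Y X : Scheme.{0})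
        (f : Y ⟶ Spec (.of k)) (g : X ⟶ Y), IsSeparated f → LocallyOfFiniteType f →
          QuasiCompact f → IsIntegral Y → Scheme.IsRegular Y → IsFinite g →
            UniversallyInjective g → Function.Surjective g.base → Scheme.HasResolution X :=
  fun h =>
  haveI : Fact (Nat.Prime 2) := ⟨Nat.prime_two⟩
  picover_false_without_isIntegralX_at 2 (h 2 Nat.prime_two)

/-- **In PICover, `IsIntegral X` may be weakened to `IsReduced X`** (but not dropped,
`picover_false_without_isIntegralX_at`): a finite universally injective surjection is a
homeomorphism, so `X` is irreducible with `Y`. [folklore] -/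
theorem picover_iff_reducedX (p : ℕ) :
    (∀ (k : Type) [Field k] [CharP k p] (Y X : Scheme.{0}) (f : Y ⟶ Spec (.of k)) (g : X ⟶ Y),
        IsSeparated f → LocallyOfFiniteType f → QuasiCompact f → IsIntegral Y →
          Scheme.IsRegular Y → IsIntegral X → IsFinite g → UniversallyInjective g →
            Function.Surjective g.base → Scheme.HasResolution X) ↔
    (∀ (k : Type) [Field k] [CharP k p] (Y X : Scheme.{0}) (f : Y ⟶ Spec (.of k)) (g : X ⟶ Y),
        IsSeparated f → LocallyOfFiniteType f → QuasiCompact f → IsIntegral Y →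
          Scheme.IsRegular Y → IsReduced X → IsFinite g → UniversallyInjective g →
            Function.Surjective g.base → Scheme.HasResolution X) := by
  refine ⟨fun h k _ _ Y X f g hs hl hq hiY hreg hred hfin hui hsurj => ?_,
    fun h k _ _ Y X f g hs hl hq hiY hreg hiX hfin hui hsurj =>
      h k Y X f g hs hl hq hiY hreg inferInstance hfin hui hsurj⟩
  have hhomeo : IsHomeomorph g.base :=
    isHomeomorph_iff_continuous_isClosedMap_bijective.mpr
      ⟨g.continuous, g.isClosedMap, g.injective, hsurj⟩
  haveI : IrreducibleSpace X := (hhomeo.homeomorph).irreducibleSpace_iff.mpr inferInstance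
  haveI : IsIntegral X := isIntegral_of_irreducibleSpace_of_isReduced X
  exact h k Y X f g hs hl hq hiY hreg inferInstance hfin hui hsurj

/-- **`IsIntegral Y` is REDUNDANT in PICover**: `Y` is reduced (regular) and irreducible (the
continuous image of the integral `X` under the surjection `g`). [folklore] -/
theorem picover_integralY_redundant (p : ℕ) :
    PicoverAt p ↔
    (∀ (k : Type) [Field k] [CharP k p] (Y X : Scheme.{0}) (f : Y ⟶ Spec (.of k)) (g : X ⟶ Y),
        IsSeparated f → LocallyOfFiniteType f → QuasiCompact f →
          Scheme.IsRegular Y → IsIntegral X → IsFinite g → UniversallyInjective g →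
            Function.Surjective g.base → Scheme.HasResolution X) := by
  refine ⟨fun h k _ _ Y X f g hs hl hq hreg hiX hfin hui hsurj => ?_,
    fun h k _ _ Y X f g hs hl hq _ hreg hiX hfin hui hsurj =>
      h k Y X f g hs hl hq hreg hiX hfin hui hsurj⟩
  haveI : IsReduced Y := hreg.isReduced
  haveI : IrreducibleSpace Y := hsurj.irreducibleSpace g.base.hom.continuous
  exact h k Y X f g hs hl hq (isIntegral_of_irreducibleSpace_of_isReduced Y) hreg hiX hfin hui hsurj

open Scheme.IdealSheafData in
/-- **PICover with `Scheme.IsRegular Y` dropped is LITERALLY `ResolutionInChar p`** (take `Y = X`,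
`g = 𝟙`; reduced → integral by components, `hasResolution_of_forall_closeds`). Regularity of
the base is THE hypothesis of PICover. [folklore] -/
theorem picover_without_regularY_iff (p : ℕ) :
    (∀ (k : Type) [Field k] [CharP k p] (Y X : Scheme.{0}) (f : Y ⟶ Spec (.of k)) (g : X ⟶ Y),
        IsSeparated f → LocallyOfFiniteType f → QuasiCompact f → IsIntegral Y →
          IsIntegral X → IsFinite g → UniversallyInjective g →
            Function.Surjective g.base → Scheme.HasResolution X) ↔
    ResolutionInChar.{0} p := by
  constructor
  · intro h k _ _ X f hs hl hq hred
    refine hasResolution_of_forall_closeds X f fun Z hZ => ?_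
    haveI := hZ
    exact h k _ _ ((vanishingIdeal Z).subschemeι ≫ f) (𝟙 _) inferInstance inferInstance
      inferInstance hZ hZ inferInstance inferInstance (fun x => ⟨x, rfl⟩)
  · intro h k _ _ Y X f g hs hl hq _ _ hfin hui hsurj
    exact h k X (g ≫ f) inferInstance inferInstance inferInstance inferInstance

open Scheme.IdealSheafData in
/-- **PICover with `Function.Surjective g.base` dropped is LITERALLY `ResolutionInChar p`**: a
closed immersion is finite and radicial, and by Chow's lemma (`ChowLemmaIntegral_holds`) plus
projective closure (`exists_projectiveClosure`) every integral separated `X` of finite type over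
`k` has a proper birational model that is an open subscheme of an integral CLOSED subscheme of
the regular integral `ℙⁿ_k`; resolutions transport back (`Scheme.HasResolution.of_isOpenImmersion`,
`Scheme.HasResolution.of_isBirational`). Surjectivity is what confines PICover to radicial
COVERS. [folklore] -/
theorem picover_without_surjective_iff (p : ℕ) :
    (∀ (k : Type) [Field k] [CharP k p] (Y X : Scheme.{0}) (f : Y ⟶ Spec (.of k)) (g : X ⟶ Y),
        IsSeparated f → LocallyOfFiniteType f → QuasiCompact f → IsIntegral Y →
          Scheme.IsRegular Y → IsIntegral X → IsFinite g → UniversallyInjective g →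
            Scheme.HasResolution X) ↔
    ResolutionInChar.{0} p := by
  constructor
  · intro h k _ _ X f hs hl hq hred
    refine hasResolution_of_forall_closeds X f fun Z hZ => ?_
    haveI := hZ
    obtain ⟨n, X', π, ι, hint', hι, hπ, -, -, U, hU, hU', hiso⟩ :=
      ChowLemmaIntegral_holds k _ ((vanishingIdeal Z).subschemeι ≫ f) inferInstance inferInstance
        inferInstance hZ
    haveI := hint'
    haveI := hι
    haveI := hπ
    obtain ⟨Xbar, j, c, hXbar, hj, hc, -, -⟩ := exists_projectiveClosure ι
    haveI := hj
    haveI := hc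
    haveI : IsProper (Literature.AlgebraicGeometry.Motives.projectiveSpace n k).hom :=
      Literature.AlgebraicGeometry.Motives.isProper_projectiveSpace n k
    have hbar : Scheme.HasResolution Xbar :=
      h k _ Xbar (Literature.AlgebraicGeometry.Motives.projectiveSpace n k).hom c inferInstance
        inferInstance inferInstance (isIntegral_projectiveSpace n k) (isRegular_projectiveSpace n k)
        hXbar inferInstance inferInstance
    exact Scheme.HasResolution.of_isBirational π ⟨U, hU, hU', hiso⟩ (hbar.of_isOpenImmersion j)
  · intro h k _ _ Y X f g hs hl hq _ _ _ hfin hui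
    exact h k X (g ≫ f) inferInstance inferInstance inferInstance inferInstance

/-- PICover at `p` with `UniversallyInjective g` DROPPED (status: open — sandwiched between
`ResolutionInChar p` and resolution of every integral scheme finite and surjective over a regular
integral base, e.g. every affine or projective variety by Noether normalisation). -/
def PicoverWithoutUIAt (p : ℕ) : Prop :=
  ∀ (k : Type) [Field k] [CharP k p] (Y X : Scheme.{0}) (f : Y ⟶ Spec (.of k)) (g : X ⟶ Y),
    IsSeparated f → LocallyOfFiniteType f → QuasiCompact f → IsIntegral Y → Scheme.IsRegular Y →
      IsIntegral X → IsFinite g → Function.Surjective g.base → Scheme.HasResolution X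

/-- The summit in characteristic `p` gives PICover-without-radiciality. [folklore] -/
theorem picoverWithoutUIAt_of_resolutionInChar {p : ℕ} (h : ResolutionInChar.{0} p) :
    PicoverWithoutUIAt p := by
  intro k _ _ Y X f g hs hl hq hiY hreg hiX hfin hsurj
  exact h k X (g ≫ f) inferInstance inferInstance inferInstance inferInstance

/-- PICover-without-radiciality gives PICover_p (the trivial direction). [folklore] -/
theorem picoverAt_of_picoverWithoutUIAt {p : ℕ} (h : PicoverWithoutUIAt p) : PicoverAt p :=
  fun k _ _ Y X f g hs hl hq hiY hreg hiX hfin _ hsurj => h k Y X f g hs hl hq hiY hreg hiX hfin hsurj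

/-- Contrapositively: a kill of PICover_p kills the UI-free statement and, if it came from a
failure of `ResolutionInChar p`, nothing more is learned. [folklore] -/
theorem not_picoverWithoutUI_of_not {p : ℕ} (h : ¬ PicoverAt p) : ¬ PicoverWithoutUIAt p :=
  fun h' => h (picoverAt_of_picoverWithoutUIAt h')

/-! ### §3 bis — PICover: `IsFinite g` is load-bearing (perfection-type radicial covers) -/

section PerfectionWitness

open Polynomial

variable (p : ℕ) [hp : Fact p.Prime]

/-- `𝔽_p[T] → E` is injective, `E` an algebraic closure of `𝔽_p(T)`. (The witness ring below is
the `p`-radical closure `𝔽_p[T]^{1/p^∞}` of `𝔽_p[T]` inside `E`: the elements of `E` some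
`p^n`-th power of which is a polynomial — Mathlib's `Subalgebra.perfectClosure 𝔽_p[T] E p`,
written out in full, no new definition.) [folklore] -/
theorem algebraMap_injective_algClosure :
    Function.Injective (algebraMap (ZMod p)[X] (AlgebraicClosure (RatFunc (ZMod p)))) := by
  rw [IsScalarTower.algebraMap_eq (ZMod p)[X] (RatFunc (ZMod p)) (AlgebraicClosure (RatFunc (ZMod p)))]
  exact (algebraMap (RatFunc (ZMod p)) _).injective.comp (RatFunc.algebraMap_injective (ZMod p))

/-- Every element of `𝔽_p[T]^{1/p^∞}` is a `p`-th power (the `p`-th root in `E` of an element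
whose `p^n`-th power is a polynomial has its `p^(n+1)`-th power a polynomial). [folklore] -/
theorem perfRad_exists_pow_eq (a : ↥(Subalgebra.perfectClosure (ZMod p)[X] (AlgebraicClosure (RatFunc (ZMod p))) p)) : ∃ b : ↥(Subalgebra.perfectClosure (ZMod p)[X] (AlgebraicClosure (RatFunc (ZMod p))) p), b ^ p = a := by
  obtain ⟨z, hz⟩ := IsAlgClosed.exists_pow_nat_eq (a : AlgebraicClosure (RatFunc (ZMod p))) hp.out.pos
  obtain ⟨n, hn⟩ := (Subalgebra.mem_perfectClosure_iff).mp a.2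
  refine ⟨⟨z, (Subalgebra.mem_perfectClosure_iff).mpr ⟨n + 1, ?_⟩⟩, Subtype.ext hz⟩
  rw [pow_succ', pow_mul, hz]
  exact hn

/-- `𝔽_p[T] → 𝔽_p[T]^{1/p^∞}` is injective. [folklore] -/
theorem perfRad_algebraMap_injective : Function.Injective (algebraMap (ZMod p)[X] (↥(Subalgebra.perfectClosure (ZMod p)[X] (AlgebraicClosure (RatFunc (ZMod p))) p))) := by
  intro a b hab
  apply algebraMap_injective_algClosure p
  have := congrArg (fun x : ↥(Subalgebra.perfectClosure (ZMod p)[X] (AlgebraicClosure (RatFunc (ZMod p))) p) => (x : AlgebraicClosure (RatFunc (ZMod p)))) hab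
  simpa using this

/-- Every element of `𝔽_p[T]^{1/p^∞}` is integral over `𝔽_p[T]`. [folklore] -/
theorem perfRad_isIntegral (a : ↥(Subalgebra.perfectClosure (ZMod p)[X] (AlgebraicClosure (RatFunc (ZMod p))) p)) : IsIntegral (ZMod p)[X] a := by
  obtain ⟨n, t, ht⟩ := (Subalgebra.mem_perfectClosure_iff).mp a.2
  have hpow : IsIntegral (ZMod p)[X] (a ^ p ^ n) := by
    have : (a ^ p ^ n : ↥(Subalgebra.perfectClosure (ZMod p)[X] (AlgebraicClosure (RatFunc (ZMod p))) p)) = algebraMap (ZMod p)[X] (↥(Subalgebra.perfectClosure (ZMod p)[X] (AlgebraicClosure (RatFunc (ZMod p))) p)) t := by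
      apply Subtype.ext
      simpa using ht.symm
    rw [this]
    exact isIntegral_algebraMap
  exact IsIntegral.of_pow (pow_pos hp.out.pos n) hpow

/-- `𝔽_p[T]^{1/p^∞}` is an integral `𝔽_p[T]`-algebra. [folklore] -/
instance perfRad_algebraIsIntegral : Algebra.IsIntegral (ZMod p)[X] (↥(Subalgebra.perfectClosure (ZMod p)[X] (AlgebraicClosure (RatFunc (ZMod p))) p)) :=
  ⟨perfRad_isIntegral p⟩

/-- **The generic point of `Spec 𝔽_p[T]^{1/p^∞}` is not open**: every non-zero `f` avoids some
non-zero prime — a prime lying over `(π)` for an irreducible `π ∈ 𝔽_p[T]` not dividing the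
polynomial `f^{p^n}`. [folklore] -/
theorem perfRad_exists_prime_not_mem (f : ↥(Subalgebra.perfectClosure (ZMod p)[X] (AlgebraicClosure (RatFunc (ZMod p))) p)) (hf : f ≠ 0) :
    ∃ Q : Ideal (↥(Subalgebra.perfectClosure (ZMod p)[X] (AlgebraicClosure (RatFunc (ZMod p))) p)), Q.IsPrime ∧ Q ≠ ⊥ ∧ f ∉ Q := by
  have hinj := perfRad_algebraMap_injective p
  obtain ⟨n, c, hc⟩ := (Subalgebra.mem_perfectClosure_iff).mp f.2
  -- `c = f^(p^n)` as elements of `Rrad`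
  have hcf : algebraMap (ZMod p)[X] (↥(Subalgebra.perfectClosure (ZMod p)[X] (AlgebraicClosure (RatFunc (ZMod p))) p)) c = f ^ p ^ n := by
    apply Subtype.ext; simpa using hc
  have hc0 : c ≠ 0 := by
    intro h0
    rw [h0, map_zero] at hcf
    exact hf (pow_eq_zero_iff (pow_pos hp.out.pos n).ne' |>.mp hcf.symm)
  -- an irreducible `π` not dividing `c`: a factor of `c * X + 1`
  have hdeg : (c * X + 1 : (ZMod p)[X]).natDegree = c.natDegree + 1 := by
    rw [Polynomial.natDegree_add_eq_left_of_natDegree_lt] <;>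
      rw [Polynomial.natDegree_mul_X hc0]
    simp
  have hne : (c * X + 1 : (ZMod p)[X]) ≠ 0 := by
    intro h0; rw [h0] at hdeg; simp at hdeg
  have hnu : ¬ IsUnit (c * X + 1 : (ZMod p)[X]) := by
    intro hu
    have := Polynomial.natDegree_eq_zero_of_isUnit hu
    omega
  obtain ⟨π, hπirr, hπdvd⟩ := WfDvdMonoid.exists_irreducible_factor hnu hne
  have hπc : ¬ π ∣ c := by
    intro hdc
    apply hπirr.not_isUnit
    have : π ∣ (c * X + 1) - c * X := dvd_sub hπdvd (dvd_mul_of_dvd_left hdc _)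
    exact isUnit_of_dvd_one (by simpa using this)
  let 𝔭 : Ideal (ZMod p)[X] := Ideal.span {π}
  haveI h𝔭 : 𝔭.IsPrime := (Ideal.span_singleton_prime hπirr.ne_zero).mpr hπirr.prime
  obtain ⟨Q, -, hQ, hQcomap⟩ := Ideal.exists_ideal_over_prime_of_isIntegral 𝔭
    (⊥ : Ideal (↥(Subalgebra.perfectClosure (ZMod p)[X] (AlgebraicClosure (RatFunc (ZMod p))) p)))
    (by
      intro a ha
      have ha0 : algebraMap (ZMod p)[X] (↥(Subalgebra.perfectClosure (ZMod p)[X] (AlgebraicClosure (RatFunc (ZMod p))) p)) a = 0 :=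
        Ideal.mem_bot.mp (Ideal.mem_comap.mp ha)
      have : a = 0 := hinj (by rw [ha0, map_zero])
      rw [this]; exact 𝔭.zero_mem)
  refine ⟨Q, hQ, ?_, ?_⟩
  · rintro rfl
    have hπmem : π ∈ (⊥ : Ideal (↥(Subalgebra.perfectClosure (ZMod p)[X] (AlgebraicClosure (RatFunc (ZMod p))) p))).comap (algebraMap (ZMod p)[X] _) := by
      rw [hQcomap]; exact Ideal.mem_span_singleton_self π
    have hπ0 : algebraMap (ZMod p)[X] (↥(Subalgebra.perfectClosure (ZMod p)[X] (AlgebraicClosure (RatFunc (ZMod p))) p)) π = 0 :=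
      Ideal.mem_bot.mp (Ideal.mem_comap.mp hπmem)
    exact hπirr.ne_zero (hinj (by rw [hπ0, map_zero]))
  · intro hfQ
    have h1 : algebraMap (ZMod p)[X] _ c ∈ Q := by
      rw [hcf]; exact Q.pow_mem_of_mem hfQ _ (pow_pos hp.out.pos n)
    have h2 : c ∈ 𝔭 := by rw [← hQcomap]; exact h1
    exact hπc (Ideal.mem_span_singleton.mp h2)

/-- **`Spec 𝔽_p[T]^{1/p^∞}` has no resolution of singularities** (root-closed domain with
non-open generic point: `not_hasResolution_spec_of_forall_exists_pow_eq`). [folklore] -/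
theorem not_hasResolution_spec_perfRad : ¬ Scheme.HasResolution (Spec (.of (↥(Subalgebra.perfectClosure (ZMod p)[X] (AlgebraicClosure (RatFunc (ZMod p))) p)))) :=
  not_hasResolution_spec_of_forall_exists_pow_eq (↥(Subalgebra.perfectClosure (ZMod p)[X] (AlgebraicClosure (RatFunc (ZMod p))) p)) hp.out.two_le (perfRad_exists_pow_eq p)
    (perfRad_exists_prime_not_mem p)

/-- **`Spec 𝔽_p[T]^{1/p^∞} → 𝔸¹ = Spec 𝔽_p[T]` is universally injective** (radicial), by the
`K`-points criterion: two ring maps `𝔽_p[T]^{1/p^∞} → K` agreeing on `𝔽_p[T]` agree on `x`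
because they agree on the polynomial `x^{p^n}` and `y ↦ y^{p^n}` is injective on the field `K`
of characteristic `p`. [folklore] -/
theorem universallyInjective_spec_perfRad :
    UniversallyInjective (Spec.map (CommRingCat.ofHom (algebraMap (ZMod p)[X] (↥(Subalgebra.perfectClosure (ZMod p)[X] (AlgebraicClosure (RatFunc (ZMod p))) p))))) := by
  refine ((tfae_universallyInjective
    (Spec.map (CommRingCat.ofHom (algebraMap (ZMod p)[X] (↥(Subalgebra.perfectClosure (ZMod p)[X] (AlgebraicClosure (RatFunc (ZMod p))) p)))))).out 0 1).mpr ?_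
  intro K _ g₁ g₂ h
  obtain ⟨φ₁, rfl⟩ := Spec.map_surjective g₁
  obtain ⟨φ₂, rfl⟩ := Spec.map_surjective g₂
  simp only [← Spec.map_comp] at h
  have h' := congrArg (fun ψ => ψ.hom) (Spec.map_injective h)
  simp only [CommRingCat.hom_comp, CommRingCat.hom_ofHom] at h'
  -- `K` has characteristic `p`
  haveI : CharP K p := by
    have ψ : ZMod p →+* K := φ₁.hom.comp ((algebraMap (ZMod p)[X] (↥(Subalgebra.perfectClosure (ZMod p)[X] (AlgebraicClosure (RatFunc (ZMod p))) p))).comp Polynomial.C)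
    exact (ψ.charP_iff_charP p).mp inferInstance
  congr 1
  ext1
  refine RingHom.ext fun x => ?_
  obtain ⟨n, t, ht⟩ := (Subalgebra.mem_perfectClosure_iff).mp x.2
  have hxt : (x ^ p ^ n : ↥(Subalgebra.perfectClosure (ZMod p)[X] (AlgebraicClosure (RatFunc (ZMod p))) p)) = algebraMap (ZMod p)[X] (↥(Subalgebra.perfectClosure (ZMod p)[X] (AlgebraicClosure (RatFunc (ZMod p))) p)) t := by
    apply Subtype.ext; simpa using ht.symm
  have key : (φ₁.hom x) ^ p ^ n = (φ₂.hom x) ^ p ^ n := by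
    rw [← map_pow, ← map_pow, hxt]
    exact congrFun (congrArg DFunLike.coe h') t
  exact (iterateFrobenius K p n).injective (by simpa only [iterateFrobenius_def] using key)

/-- `Spec 𝔽_p[T]^{1/p^∞} → 𝔸¹` is surjective (integral with injective ring map: lying over).
[folklore] -/
theorem surjective_spec_perfRad :
    Function.Surjective (Spec.map (CommRingCat.ofHom (algebraMap (ZMod p)[X] (↥(Subalgebra.perfectClosure (ZMod p)[X] (AlgebraicClosure (RatFunc (ZMod p))) p))))).base := by
  haveI : FaithfulSMul (ZMod p)[X] (↥(Subalgebra.perfectClosure (ZMod p)[X] (AlgebraicClosure (RatFunc (ZMod p))) p)) :=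
    (faithfulSMul_iff_algebraMap_injective _ _).mpr (perfRad_algebraMap_injective p)
  intro y
  obtain ⟨x, hx⟩ := Algebra.IsIntegral.comap_surjective (ZMod p)[X] (↥(Subalgebra.perfectClosure (ZMod p)[X] (AlgebraicClosure (RatFunc (ZMod p))) p)) y
  exact ⟨x, hx⟩

/-- **PICover with `IsFinite g` dropped is FALSE at every prime**: `Spec 𝔽_p[T]^{1/p^∞} → 𝔸¹`
is universally injective and surjective from an integral scheme onto the regular integral affine
line, but `Spec 𝔽_p[T]^{1/p^∞}` has no resolution — passing to a perfection-type radicial cover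
destroys Noetherianity at every closed point. Any proof of PICover must use finiteness of `g`.
[folklore] -/
theorem picover_false_without_isFinite_at :
    ¬ ∀ (k : Type) [Field k] [CharP k p] (Y X : Scheme.{0}) (f : Y ⟶ Spec (.of k)) (g : X ⟶ Y),
        IsSeparated f → LocallyOfFiniteType f → QuasiCompact f → IsIntegral Y →
          Scheme.IsRegular Y → IsIntegral X → UniversallyInjective g →
            Function.Surjective g.base → Scheme.HasResolution X := by
  intro h
  let f : Spec (.of (ZMod p)[X]) ⟶ Spec (.of (ZMod p)) :=
    Spec.map (CommRingCat.ofHom (algebraMap (ZMod p) (ZMod p)[X]))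
  haveI : LocallyOfFiniteType f :=
    (HasRingHomProperty.Spec_iff (P := @LocallyOfFiniteType)).mpr
      (RingHom.finiteType_algebraMap.mpr inferInstance)
  let g : Spec (.of (↥(Subalgebra.perfectClosure (ZMod p)[X] (AlgebraicClosure (RatFunc (ZMod p))) p))) ⟶ Spec (.of (ZMod p)[X]) :=
    Spec.map (CommRingCat.ofHom (algebraMap (ZMod p)[X] (↥(Subalgebra.perfectClosure (ZMod p)[X] (AlgebraicClosure (RatFunc (ZMod p))) p))))
  exact not_hasResolution_spec_perfRad p
    (h (ZMod p) (Spec (.of (ZMod p)[X])) (Spec (.of (↥(Subalgebra.perfectClosure (ZMod p)[X] (AlgebraicClosure (RatFunc (ZMod p))) p)))) f g inferInstance inferInstance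
      inferInstance inferInstance (Scheme.isRegular_Spec (.of (ZMod p)[X])) inferInstance
      (universallyInjective_spec_perfRad p) (surjective_spec_perfRad p))

end PerfectionWitness

/-! ## §4 Degenerate instances do not bite; known cases -/

/-- **Non-vacuity of PIAlt at every prime**: hypotheses jointly satisfiable, conclusion true at
the witness (`X = Spec 𝔽_p`, `g = 𝟙`, `U = ⊤`). [folklore] -/
theorem pialt_hypotheses_satisfiable (p : ℕ) [Fact p.Prime] :
    ∃ (k : Type) (_ : Field k) (_ : CharP k p) (X : Scheme.{0}) (f : X ⟶ Spec (.of k)),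
      IsSeparated f ∧ LocallyOfFiniteType f ∧ QuasiCompact f ∧ IsIntegral X ∧
        ∃ (X' : Scheme.{0}) (g : X' ⟶ X), IsProper g ∧ IsIntegral X' ∧ Scheme.IsRegular X' ∧
          Function.Surjective g.base ∧ ∃ U : X.Opens, Dense (U : Set X) ∧ IsFinite (g ∣_ U) ∧
            UniversallyInjective (g ∣_ U) := by
  refine ⟨ZMod p, inferInstance, inferInstance, Spec (.of (ZMod p)), 𝟙 _, inferInstance,
    inferInstance, inferInstance, inferInstance, Spec (.of (ZMod p)), 𝟙 _, inferInstance,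
    inferInstance, Scheme.isRegular_Spec (.of (ZMod p)), fun x => ⟨x, rfl⟩, ⊤, by simp,
    inferInstance, inferInstance⟩

/-- **Non-vacuity of PICover at every prime** (`Y = X = Spec 𝔽_p`, `g = 𝟙`). [folklore] -/
theorem picover_hypotheses_satisfiable (p : ℕ) [Fact p.Prime] :
    ∃ (k : Type) (_ : Field k) (_ : CharP k p) (Y X : Scheme.{0}) (f : Y ⟶ Spec (.of k))
      (g : X ⟶ Y), IsSeparated f ∧ LocallyOfFiniteType f ∧ QuasiCompact f ∧ IsIntegral Y ∧
        Scheme.IsRegular Y ∧ IsIntegral X ∧ IsFinite g ∧ UniversallyInjective g ∧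
          Function.Surjective g.base ∧ Scheme.HasResolution X :=
  ⟨ZMod p, inferInstance, inferInstance, Spec (.of (ZMod p)), Spec (.of (ZMod p)), 𝟙 _, 𝟙 _,
    inferInstance, inferInstance, inferInstance, inferInstance, Scheme.isRegular_Spec (.of (ZMod p)),
    inferInstance, inferInstance, inferInstance, fun x => ⟨x, rfl⟩,
    (Scheme.isRegular_Spec (.of (ZMod p))).hasResolution⟩

/-- **Dimension ≤ 3 of PIAlt is settled** (modulo the named fact `CossartPiltant2019`, via
`abramovichOort_of_cossartPiltant2019`). [cite: CossartPiltant2019, Thm. 1.1] -/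
theorem pialt_of_dim_le_three (hCP : CossartPiltant2019.{0}) {p : ℕ} (k : Type) [Field k]
    [CharP k p] (X : Scheme.{0}) (f : X ⟶ Spec (.of k)) [IsSeparated f] [LocallyOfFiniteType f]
    [QuasiCompact f] [IsIntegral X] (hdim : topologicalKrullDim X ≤ 3) :
    ∃ (X' : Scheme.{0}) (g : X' ⟶ X), IsProper g ∧ IsIntegral X' ∧ Scheme.IsRegular X' ∧
      Function.Surjective g.base ∧ ∃ U : X.Opens, Dense (U : Set X) ∧ IsFinite (g ∣_ U) ∧
        UniversallyInjective (g ∣_ U) := by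
  obtain ⟨Y, φ, hφ, hreg⟩ := abramovichOort_of_cossartPiltant2019 hCP k X f hdim
  obtain ⟨U, hU, hfin, hui⟩ := hφ.exists_dense
  haveI := hφ.surjective
  exact ⟨Y, φ, hφ.isProper, hφ.isIntegral, hreg, φ.surjective, U, hU, hfin, hui⟩

/-- A finite universally injective morphism is a closed embedding of underlying spaces, so it
does not raise the (topological Krull) dimension. [folklore] -/
theorem topologicalKrullDim_le_of_isFinite_of_universallyInjective {X Y : Scheme.{0}} (g : X ⟶ Y)
    [IsFinite g] [UniversallyInjective g] : topologicalKrullDim X ≤ topologicalKrullDim Y :=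
  (IsClosedEmbedding.of_continuous_injective_isClosedMap g.continuous g.injective
    g.isClosedMap).isInducing.topologicalKrullDim_le

/-- **Dimension ≤ 3 of PICover is settled** (modulo `CossartPiltant2019`): `dim X ≤ dim Y ≤ 3`
and `X` is a reduced separated `k`-scheme of finite type via `g ≫ f`.
[cite: CossartPiltant2019, Thm. 1.1] -/
theorem picover_of_dim_le_three (hCP : CossartPiltant2019.{0}) {p : ℕ} (k : Type) [Field k]
    [CharP k p] (Y X : Scheme.{0}) (f : Y ⟶ Spec (.of k)) (g : X ⟶ Y) [IsSeparated f]
    [LocallyOfFiniteType f] [QuasiCompact f] [IsIntegral X] [IsFinite g] [UniversallyInjective g]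
    (hdim : topologicalKrullDim Y ≤ 3) : Scheme.HasResolution X :=
  hCP k X (g ≫ f) inferInstance inferInstance inferInstance inferInstance
    ((topologicalKrullDim_le_of_isFinite_of_universallyInjective g).trans hdim)

/-- The empty scheme and spectra of fields are regular, hence are their own resolutions /
alterations: the smallest instances of both conjuncts hold. [folklore] -/
theorem hasResolution_of_isEmpty (X : Scheme.{0}) [IsEmpty X] : Scheme.HasResolution X :=
  Scheme.IsRegular.hasResolution fun x => isEmptyElim x

/-! ## §5 Natural strengthenings and near-misses

Formal: PICover's conclusion cannot be strengthened to "`X` regular" (below, every prime). The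
other formal strengthenings already settled: "radicial over a dense open" ↦ "isomorphism over a
dense open" is resolution itself (§1); "drop radiciality" is de Jong's theorem (§2 bis); PICover
with any of `IsRegular Y` / surjectivity dropped is the summit at `p` (§3). Near-misses (a), (d)
of the module docstring stay prose; no `sorry` is kept in this file. -/

section Cusp

open Polynomial

variable (K : Type) [Field K] (n : ℕ)

/-- Elements of the higher cusp algebra `K[Tⁿ, Tⁿ⁺¹] = Algebra.adjoin K {Tⁿ, Tⁿ⁺¹} ⊆ K[T]`
(`n ≥ 2`) have no linear term. [folklore] -/
theorem hcusp_coeff_one_eq_zero (hn : 2 ≤ n) {s : K[X]}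
    (hs : s ∈ Algebra.adjoin K ({X ^ n, X ^ (n + 1)} : Set K[X])) : s.coeff 1 = 0 := by
  refine Algebra.adjoin_induction (p := fun s _ => s.coeff 1 = 0) ?_ ?_ ?_ ?_ hs
  · intro x hx
    simp only [Set.mem_insert_iff, Set.mem_singleton_iff] at hx
    rcases hx with hx | hx <;> rw [hx, Polynomial.coeff_X_pow] <;> simp <;> omega
  · intro r
    show (algebraMap K K[X] r).coeff 1 = 0
    rw [Polynomial.algebraMap_apply, Polynomial.coeff_C]
    simp
  · intro x y _ _ hx hy
    simp [hx, hy]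
  · intro x y _ _ hx hy
    simp [Polynomial.coeff_mul, Finset.Nat.sum_antidiagonal_succ, hx, hy]

/-- `T ∉ K[Tⁿ, Tⁿ⁺¹]` for `n ≥ 2`. [folklore] -/
theorem hcusp_X_not_mem (hn : 2 ≤ n) :
    (X : K[X]) ∉ Algebra.adjoin K ({X ^ n, X ^ (n + 1)} : Set K[X]) := fun h => by
  simpa using hcusp_coeff_one_eq_zero K n hn h

/-- `K[Tⁿ, Tⁿ⁺¹]` (`n ≥ 2`) is not integrally closed: `T = Tⁿ⁺¹/Tⁿ` satisfies `Tⁿ ∈ K[Tⁿ, Tⁿ⁺¹]`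
but `T ∉ K[Tⁿ, Tⁿ⁺¹]`. [folklore] -/
theorem hcusp_not_isIntegrallyClosed (hn : 2 ≤ n) :
    ¬ IsIntegrallyClosed ↥(Algebra.adjoin K ({X ^ n, X ^ (n + 1)} : Set K[X])) := by
  intro h
  set A : Subalgebra K K[X] := Algebra.adjoin K ({X ^ n, X ^ (n + 1)} : Set K[X]) with hA
  have hmem_n : (X ^ n : K[X]) ∈ A := Algebra.subset_adjoin (by simp)
  have hmem_n1 : (X ^ (n + 1) : K[X]) ∈ A := Algebra.subset_adjoin (by simp)
  let a : A := ⟨X ^ n, hmem_n⟩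
  let b : A := ⟨X ^ (n + 1), hmem_n1⟩
  have ha : a ≠ 0 := by
    intro h0
    have := congrArg Subtype.val h0
    simp [a] at this
  let L := FractionRing A
  have haL : algebraMap A L a ≠ 0 := fun h0 =>
    ha ((IsFractionRing.injective A L) (h0.trans (map_zero _).symm))
  let x : L := algebraMap A L b / algebraMap A L a
  have hxn : x ^ n = algebraMap A L a := by
    rw [div_pow, div_eq_iff (pow_ne_zero n haL), ← map_pow, ← map_pow, ← map_mul]
    congr 1
    apply Subtype.ext
    simp [a, b]
    ring
  obtain ⟨y, hy⟩ := IsIntegrallyClosed.exists_algebraMap_eq_of_isIntegral_pow (R := A) (K := L)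
    (by omega : 0 < n) (hxn ▸ isIntegral_algebraMap)
  have hy' : algebraMap A L (y * a) = algebraMap A L b := by
    rw [map_mul, hy, div_mul_cancel₀ _ haL]
  have hy'' : y * a = b := IsFractionRing.injective A L hy'
  have hval : (y : K[X]) * X ^ n = X ^ (n + 1) := by
    have := congrArg Subtype.val hy''
    simpa [a, b] using this
  have hyX : (y : K[X]) = X := by
    have hXn : (X ^ n : K[X]) ≠ 0 := pow_ne_zero n X_ne_zero
    apply mul_right_cancel₀ hXn
    rw [hval]; ring
  have hXA : (X : K[X]) ∈ A := by rw [← hyX]; exact y.2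
  exact hcusp_X_not_mem K n hn hXA

/-- Some maximal ideal of `K[Tⁿ, Tⁿ⁺¹]` has a NON-regular local ring (else every localisation
would be integrally closed — `isIntegrallyClosed_of_isRegularLocalRing`, Matsumura 19.4 — hence
so would the ring, `IsIntegrallyClosed.of_localization_maximal`). [folklore] -/
theorem hcusp_exists_not_isRegularLocalRing (hn : 2 ≤ n) :
    ∃ (m : Ideal ↥(Algebra.adjoin K ({X ^ n, X ^ (n + 1)} : Set K[X]))) (_ : m.IsMaximal),
      ¬ IsRegularLocalRing (Localization.AtPrime m) := by
  by_contra hall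
  simp only [not_exists, not_not] at hall
  refine hcusp_not_isIntegrallyClosed K n hn
    (IsIntegrallyClosed.of_localization_maximal fun m _ hm => ?_)
  haveI := hall m hm
  exact isIntegrallyClosed_of_isRegularLocalRing _

/-- **The higher cusp `Spec K[Tⁿ, Tⁿ⁺¹]` (`n ≥ 2`) is not a regular scheme.** [folklore] -/
theorem not_isRegular_spec_hcusp (hn : 2 ≤ n) :
    ¬ Scheme.IsRegular (Spec (.of ↥(Algebra.adjoin K ({X ^ n, X ^ (n + 1)} : Set K[X])))) := by
  intro h
  obtain ⟨m, hm, hreg⟩ := hcusp_exists_not_isRegularLocalRing K n hn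
  let x : PrimeSpectrum ↥(Algebra.adjoin K ({X ^ n, X ^ (n + 1)} : Set K[X])) := ⟨m, hm.isPrime⟩
  haveI := h x
  exact hreg (IsRegularLocalRing.of_ringEquiv
    (Spec.stalkIso (.of ↥(Algebra.adjoin K ({X ^ n, X ^ (n + 1)} : Set K[X]))) x).commRingCatIsoToRingEquiv)

end Cusp

section CuspCover

open Polynomial

variable (p : ℕ) [hp : Fact p.Prime]

/-- The structure map `𝔽_p[s] → 𝔽_p[T^p, T^{p+1}]`, `s ↦ T^p`, as a ring homomorphism. -/
theorem X_pow_mem_hcusp (K : Type) [Field K] (n : ℕ) :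
    (X ^ n : K[X]) ∈ Algebra.adjoin K ({X ^ n, X ^ (n + 1)} : Set K[X]) :=
  Algebra.subset_adjoin (by simp)

/-- Over `𝔽_p`, `expand p f = f ^ p`. [folklore] -/
theorem expand_eq_pow_zmod (f : (ZMod p)[X]) : expand (ZMod p) p f = f ^ p := by
  have h := Polynomial.map_frobenius_expand p f
  rwa [ZMod.frobenius_zmod, Polynomial.map_id] at h

/-- The map `𝔽_p[s] → 𝔽_p[T^p, T^{p+1}] ⊆ 𝔽_p[T]`, `s ↦ T^p`, is `expand p` on underlying
polynomials. [folklore] -/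
theorem coe_hcuspMap (q : (ZMod p)[X]) :
    ((Polynomial.aeval (R := ZMod p)
      (⟨X ^ p, X_pow_mem_hcusp (ZMod p) p⟩ :
        ↥(Algebra.adjoin (ZMod p) ({X ^ p, X ^ (p + 1)} : Set (ZMod p)[X]))) q :
        ↥(Algebra.adjoin (ZMod p) ({X ^ p, X ^ (p + 1)} : Set (ZMod p)[X]))) : (ZMod p)[X]) =
      expand (ZMod p) p q := by
  change (Algebra.adjoin (ZMod p) ({X ^ p, X ^ (p + 1)} : Set (ZMod p)[X])).val
      (Polynomial.aeval (R := ZMod p) _ q) = _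
  rw [← Polynomial.aeval_algHom_apply, Polynomial.coe_expand, Polynomial.aeval_def,
    Polynomial.algebraMap_eq]
  rfl

/-- For `a ∈ 𝔽_p[T^p, T^{p+1}] ⊆ 𝔽_p[T]`: `a ^ p` is the image of the polynomial `a` under
`s ↦ T^p` (over `𝔽_p`, `expand p a = a ^ p`). [folklore] -/
theorem hcusp_pow_p_eq (a : ↥(Algebra.adjoin (ZMod p) ({X ^ p, X ^ (p + 1)} : Set (ZMod p)[X]))) :
    a ^ p = Polynomial.aeval (R := ZMod p)
      (⟨X ^ p, X_pow_mem_hcusp (ZMod p) p⟩ :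
        ↥(Algebra.adjoin (ZMod p) ({X ^ p, X ^ (p + 1)} : Set (ZMod p)[X]))) (a : (ZMod p)[X]) := by
  apply Subtype.ext
  rw [SubmonoidClass.coe_pow, coe_hcuspMap, expand_eq_pow_zmod]

/-- **The radicial finite cover `Spec 𝔽_p[T^p, T^{p+1}] → 𝔸¹ = Spec 𝔽_p[s]` (`s ↦ T^p`) is
universally injective**: two ring maps to a field agreeing on `𝔽_p[T^p]` agree on `a`, since they
agree on `a^p ∈ 𝔽_p[T^p]` and Frobenius is injective on fields of characteristic `p`. [folklore] -/
theorem universallyInjective_hcuspCover :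
    UniversallyInjective (Spec.map (CommRingCat.ofHom (Polynomial.aeval (R := ZMod p)
      (⟨X ^ p, X_pow_mem_hcusp (ZMod p) p⟩ :
        ↥(Algebra.adjoin (ZMod p) ({X ^ p, X ^ (p + 1)} : Set (ZMod p)[X])))).toRingHom)) := by
  refine ((tfae_universallyInjective _).out 0 1).mpr ?_
  intro K _ g₁ g₂ h
  obtain ⟨φ₁, rfl⟩ := Spec.map_surjective g₁
  obtain ⟨φ₂, rfl⟩ := Spec.map_surjective g₂
  simp only [← Spec.map_comp] at h
  have h' := congrArg (fun ψ => ψ.hom) (Spec.map_injective h)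
  simp only [CommRingCat.hom_comp, CommRingCat.hom_ofHom] at h'
  haveI : CharP K p := by
    have ψ : ZMod p →+* K := φ₁.hom.comp (algebraMap (ZMod p) _)
    exact (ψ.charP_iff_charP p).mp inferInstance
  congr 1
  ext1
  refine RingHom.ext fun a => ?_
  have key : (φ₁.hom a) ^ p = (φ₂.hom a) ^ p := by
    rw [← map_pow, ← map_pow, hcusp_pow_p_eq]
    exact congrFun (congrArg DFunLike.coe h') (a : (ZMod p)[X])
  exact (frobenius K p).injective (by simpa only [frobenius_def] using key)

/-- The cover is finite: `𝔽_p[T^p, T^{p+1}]` is integral (`a^p ∈ 𝔽_p[T^p]`) and of finite type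
over `𝔽_p[s]`. [folklore] -/
theorem isFinite_hcuspCover :
    IsFinite (Spec.map (CommRingCat.ofHom (Polynomial.aeval (R := ZMod p)
      (⟨X ^ p, X_pow_mem_hcusp (ZMod p) p⟩ :
        ↥(Algebra.adjoin (ZMod p) ({X ^ p, X ^ (p + 1)} : Set (ZMod p)[X])))).toRingHom)) := by
  rw [IsFinite.SpecMap_iff]
  set ψ := (Polynomial.aeval (R := ZMod p)
      (⟨X ^ p, X_pow_mem_hcusp (ZMod p) p⟩ :
        ↥(Algebra.adjoin (ZMod p) ({X ^ p, X ^ (p + 1)} : Set (ZMod p)[X])))).toRingHom with hψ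
  show ψ.Finite
  have hft : ψ.FiniteType := by
    refine RingHom.FiniteType.of_comp_finiteType (f := Polynomial.C) ?_
    have : ψ.comp Polynomial.C = algebraMap (ZMod p) _ := by
      ext r
      simp [hψ]
    rw [this]
    refine RingHom.finiteType_algebraMap.mpr ⟨(Subalgebra.fg_top _).mpr ⟨{X ^ p, X ^ (p + 1)}, ?_⟩⟩
    simp
  have hint : ψ.IsIntegral := by
    intro a
    refine ⟨Polynomial.X ^ p - Polynomial.C (a : (ZMod p)[X]), Polynomial.monic_X_pow_sub_C _ hp.out.ne_zero, ?_⟩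
    rw [eval₂_sub, eval₂_X_pow, eval₂_C, hcusp_pow_p_eq, sub_eq_zero]
    rfl
  exact hint.to_finite hft

/-- The cover is surjective (finite with injective ring map: lying over). [folklore] -/
theorem surjective_hcuspCover :
    Function.Surjective (Spec.map (CommRingCat.ofHom (Polynomial.aeval (R := ZMod p)
      (⟨X ^ p, X_pow_mem_hcusp (ZMod p) p⟩ :
        ↥(Algebra.adjoin (ZMod p) ({X ^ p, X ^ (p + 1)} : Set (ZMod p)[X])))).toRingHom)).base := by
  set ψ := (Polynomial.aeval (R := ZMod p)
      (⟨X ^ p, X_pow_mem_hcusp (ZMod p) p⟩ :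
        ↥(Algebra.adjoin (ZMod p) ({X ^ p, X ^ (p + 1)} : Set (ZMod p)[X])))).toRingHom with hψ
  have hinj : Function.Injective ψ := by
    intro f g hfg
    have := congrArg Subtype.val hfg
    rw [hψ] at this
    change ((Polynomial.aeval (R := ZMod p) _ f : ↥(Algebra.adjoin (ZMod p)
        ({X ^ p, X ^ (p + 1)} : Set (ZMod p)[X]))) : (ZMod p)[X]) =
      ((Polynomial.aeval (R := ZMod p) _ g : ↥(Algebra.adjoin (ZMod p)
        ({X ^ p, X ^ (p + 1)} : Set (ZMod p)[X]))) : (ZMod p)[X]) at this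
    rw [coe_hcuspMap, coe_hcuspMap] at this
    exact Polynomial.expand_injective hp.out.pos this
  have hint : ψ.IsIntegral := by
    intro a
    refine ⟨Polynomial.X ^ p - Polynomial.C (a : (ZMod p)[X]), Polynomial.monic_X_pow_sub_C _ hp.out.ne_zero, ?_⟩
    rw [eval₂_sub, eval₂_X_pow, eval₂_C, hcusp_pow_p_eq, sub_eq_zero]
    rfl
  intro y
  obtain ⟨x, hx⟩ := hint.comap_surjective hinj y
  exact ⟨x, hx⟩

/-- **PICover has content at every prime already for curves: the conclusion `HasResolution X`
cannot be strengthened to `Scheme.IsRegular X`.** Witness: the radicial finite cover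
`Spec 𝔽_p[T^p, T^{p+1}] → 𝔸¹_{𝔽_p}` (finite, universally injective, surjective, integral
source and regular integral base of finite type over `𝔽_p`) has a SINGULAR source
(`not_isRegular_spec_hcusp`). This is also a non-degenerate inhabitant of the hypotheses of
PICover (where the conclusion holds by normalisation / `CossartPiltant2019`). [folklore] -/
theorem picover_strengthening_isRegular_false :
    ¬ ∀ (k : Type) [Field k] [CharP k p] (Y X : Scheme.{0}) (f : Y ⟶ Spec (.of k)) (g : X ⟶ Y),
        IsSeparated f → LocallyOfFiniteType f → QuasiCompact f → IsIntegral Y →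
          Scheme.IsRegular Y → IsIntegral X → IsFinite g → UniversallyInjective g →
            Function.Surjective g.base → Scheme.IsRegular X := by
  intro h
  let f : Spec (.of (ZMod p)[X]) ⟶ Spec (.of (ZMod p)) :=
    Spec.map (CommRingCat.ofHom (algebraMap (ZMod p) (ZMod p)[X]))
  haveI : LocallyOfFiniteType f :=
    (HasRingHomProperty.Spec_iff (P := @LocallyOfFiniteType)).mpr
      (RingHom.finiteType_algebraMap.mpr inferInstance)
  exact not_isRegular_spec_hcusp (ZMod p) p hp.out.two_le
    (h (ZMod p) (Spec (.of (ZMod p)[X])) _ f _ inferInstance inferInstance inferInstance inferInstance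
      (Scheme.isRegular_Spec (.of (ZMod p)[X])) inferInstance (isFinite_hcuspCover p)
      (universallyInjective_hcuspCover p) (surjective_hcuspCover p))

end CuspCover

/-! ## Targets

None yet: payload `stuck_stubs = []` (no line picked on this crux). -/

end Summit.ResolutionOfSingularities.ResolutionOfSingularities.Cruxes.PalterationThesis.Disproof

end
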